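/-
Copyright: b2b-lace packet (LEAN TYPING SEAT 1 gen 34, node KU-SEP-SINKEPT-BALL, part B).
The TRUNCATION + LITERAL-SUBSTITUTION BUDGET of sin²-KEPT product slices, one-seed form: the cost is
`[((1+2δ_J)^d − 1) + (Π_μ(α′_μ+η_μ) − Π_μ α′_μ)/(2π)^d]` times the KEPT SEED — `Tw_{n+2}[sin²(k_{j₀})](0;0)` for
one kept factor (moment index `n+2`), `Tw_{n+3}[sin²(k_{j₀}) sin²(k_{j₁})](0;0)` for two (index `n+3`) — in the
sharp range `d ≥ 2n+3` (one resp. two `Ĉ`-powers beyond the bounded-weight range); the kept seeds are shifted plain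
seeds and the kept literal objects are lower-moment plain literal objects (recurrence substitution).  Elementary
given the row files; hypothesis-free; no `sorry`; nothing at a specific dimension.
-/
import Literature.Probability.FitznerVanDerHofstad2017.SrwTwistKeptRowOrderBall
import Literature.Probability.FitznerVanDerHofstad2017.SrwTwistProductRowPerturbation
import Literature.Probability.LatticeModels.BesselIRatioBounds
import HarnessLib

/-!
# The kept-slice budget (one-seed form)

CITATION HEADER (PLACEMENT v2). Part of the certified REPRODUCTION of the numerical inputs of
R. Fitzner, R. van der Hofstad, *Generalized approach to the non-backtracking lace expansion*,
Probab. Theory Related Fields 169 (2017) 1041–1119 [NoBLE17-I] (arXiv:1506.07969), §3.3.3 and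
(3.34)–(3.38) p. 1070–1071, §5.1.1 (5.2)–(5.5) p. 1089–1090, §5.2 (5.9)–(5.10), (5.14) p. 1092, as consumed
by *Mean-field behavior for nearest-neighbor percolation in `d > 10`*, Electron. J. Probab. 22 (2017) no. 43.
Origin: build `lace`, unit `b2b-lace-lean1-g34`, node KU-SEP-SINKEPT-BALL part (B) (what-if /
input-certification support; d-free, number-free; nothing here is a certificate).

## What is proved, and why

`SrwTwistSinKeptSlices.lean` writes the sin²-kept slices `Tw_{n+2}[Π_μ cos^{a_μ}(k_μ) · sin²(k_{j₀})](m e_i; β)`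
as Schwinger integrals of products of one-dimensional rows, finite for `d ≥ 2n+3` (one `Ĉ`-power more than a
bounded weight allows); `SrwTwistKeptRowOrderBall.lean` bounds each row's truncation RELATIVE to its own
anchor `A_μ(v) = ∫ G_μ e^{v cos t} dt` (`G_μ = 1`: `2π I_0`; `G_μ = sin²`: `π(I_0 − I_2)`).  Here the two are
assembled:

* `abs_prodRowObj_sub_prodRowObj_le_of_anchor` — product-object perturbation with ARBITRARY nonnegative
  anchors `G_μ(τ)`: `‖R′_μ‖ ≤ α′_μ G_μ`, `‖R_μ − R′_μ‖ ≤ η_μ G_μ` give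
  `|Obj_n(R) − Obj_n(R′)| ≤ (Π(α′+η) − Πα′) · Obj_n(G)`, `Obj_n(R) = (n!)⁻¹ ∫₀^∞ τⁿ e^{−τ} Re Π_μ R_μ(τ) dτ/(2π)^d`
  (the `I_0`-anchored case is `SrwTwistProductRowPerturbation.abs_prodRowObj_sub_prodRowObj_le`);
* `abs_rowObj_sub_prodTruncObj_le` — the abstract two-piece budget: rows `T_μ` with `‖T_μ‖ ≤ A_μ`, folded
  truncations `P_μ(c) = Σ_{j≤J} ε_j W_{μ,j} c_{μ,j}` with `‖T_μ − P_μ(c)‖ ≤ 2δ A_μ` and `‖W_{μ,j}‖ ≤ A_μ/(2π)` give,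
  for any second coefficient table `c′`,
  `|Obj_n(T) − Obj_n(P(c′))| ≤ [((1+2δ)^d − 1) + (Π(α′+η) − Πα′)/(2π)^d] · Obj_n(A)`,
  `α′_μ = Σ ε_j‖c′_{μ,j}‖`, `η_μ = Σ ε_j‖c_{μ,j} − c′_{μ,j}‖`;
* **`abs_srwTwist_prodCosPowSinSq_sub_prodRowObj_le`** — the instantiation for ONE kept `sin²` at `j₀`:
  for `d ≥ 2n+3`, `m ≠ 0`,
  `|Tw_{n+2}[Π_μ cos^{a_μ} sin²_{j₀}](m e_i; β) − Obj_{n+1}(P(c′))|`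
  `≤ [((1+2δ_J(β/d))^d − 1) + (Π(α′+η) − Πα′)/(2π)^d] · Tw_{n+2}[sin²(k_{j₀})](0; 0)`,
  with the kept row's weights `W^{(a)}_j − W^{(a+2)}_j` at `μ = j₀` and `W^{(a_μ)}_j` elsewhere, `c_{μ,j} = 2π iʲ J_j(β/d)`;
  the integrability of the kept anchor product `τ^{n+1} e^{−τ} (2πI_0)^{d−1} π(I_0−I_2)(τ/d)` on `(0,∞)` for
  `d ≥ 2n+3` is `(I_0 − I_2)(v) = 2I_1(v)/v ≤ 2I_0(v)/v` (DLMF 10.29.1) on top of the origin seed's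
  (`integrableOn_pow_mul_srwHeatKernel_zero_pow`), and `Obj_{n+1}(A) = Tw_{n+2}[sin²(k_{j₀})](0;0)` is the
  Schwinger formula again;
* **`abs_srwTwist_prodCosPowSinSqSinSq_sub_prodRowObj_le`** — the instantiation for TWO kept factors at
  `j₀, j₁` (arbitrary; a `sin⁴` when `j₀ = j₁`): for `d ≥ 2n+3`, `m ≠ 0`,
  `|Tw_{n+3}[Π_μ cos^{a_μ} sin²_{j₀} sin²_{j₁}](m e_i; β) − Obj_{n+2}(P(c′))| ≤ [same bracket] · Tw_{n+3}[sin²_{j₀} sin²_{j₁}](0; 0)`,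
  kept rows `W^{(a)} − W^{(a+2)}` (one `sin²`) and `W^{(a)} − 2W^{(a+2)} + W^{(a+4)}` (`sin⁴`), anchors
  `π(I_0 − I_2)` and `(π/4)(3I_0 − 4I_2 + I_4) = 6π I_2/v²` (`three_besselI_zero_sub_add_eq_div_sq`), the anchor
  product dominated by `3d²(2π)^d τⁿ q_{τ/d}(0)^d` (`integrableOn_pow_succ_succ_mul_exp_neg_mul_prod_keptAnchor₂`),
  seed identity `srwTwist_sinSq_sinSq_zero_eq_integral_keptAnchor₂`.

The cost bracket is the one of `SrwTwistProductSliceBudget.lean` (plain slices) with the relative truncation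
radius `δ_J(β/d) = Σ_{l≥0} |J_{l+J+1}(β/d)|`, and the kept seeds are NOT new inputs:

* **`srwTwist_sinSq_zero_eq_srwI`**, **`srwTwist_sinSq_sinSq_zero_eq_srwI`** — KEPT SEEDS ARE SHIFTED PLAIN
  SEEDS: for `d ≥ 2n+3`, `Tw_{n+2}[sin²_{j₀}](0;0) = (d/(n+1))·I_{n+1,0}(e_{j₀})` and
  `Tw_{n+3}[sin²_{j₀} sin²_{j₁}](0;0) = c·d²/((n+1)(n+2))·I_{n+1,0}(e_{j₀}+e_{j₁})` (`c = 1` if `j₀ ≠ j₁`, `c = 3` if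
  `j₀ = j₁`, level `2e_{j₀}`): the kept anchors `π(I_0 − I_2) = 2πI_1·(d/τ)` and `(π/4)(3I_0 − 4I_2 + I_4) =
  6πI_2·(d/τ)²` trade the surplus powers of `τ` for Bessel indices, and `I_{n+1,0}(x) = (n!)⁻¹∫₀^∞ tⁿ Π_μ q_{t/d}(x_μ) dt`
  (`srwI_succ_zero_eq_integral_prod_srwHeatKernel_div`, (5.4)) is the programme's existing currency (3.35).

Nor are the kept literal objects:

* **`keptLitObj_eq_mul_recurrenceLitObj`**, **`keptLitObj₂_eq_mul_recurrenceLitObj`** — KERNEL FORM OF THE KEPT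
  LITERAL OBJECTS: at the budgets' top moment index the kept row's individual Bessel summands are divergent plain
  seeds (only their cancelling combination is finite), so the literal object `Obj_{n+1}(P(c′))` (resp.
  `Obj_{n+2}(P(c′))`) is rewritten, coordinate by coordinate and for every `τ > 0`, through the recurrence forms of
  `SrwTwistKeptRowOrderBall` — `W^{(a)}_j − W^{(a+2)}_j = 2^{-a}Σ_s C(a,s)((k+1)I_{k+1} − (k−1)I_{k−1})(v)/(2v)` and
  `W^{(a)}_j − 2W^{(a+2)}_j + W^{(a+4)}_j = 2^{-a}Σ_s C(a,s)((k+2)(k+3)I_{k+2} − 2k²I_k + (k−2)(k−3)I_{k−2})(v)/(4v²)`,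
  `k = jm − (2s−a)`, `v = τ/d` (DLMF 10.29.1) — and the factors `d/(2τ)` are absorbed into the moment:
  `Obj_{n+1}(P(c′)) = (d/(2(n+1))) · Obj_n(P̃(c′))` and `Obj_{n+2}(P(c′)) = (d²/(4(n+1)(n+2))) · Obj_n(P̃(c′))` with the
  polynomially weighted recurrence rows `P̃` at the kept coordinates — finite signed sums of plain literal objects
  of LOWER moment index, i.e. of the existing certified kernel's currency.  (Pure identities for `0 < d`; the
  left sides are verbatim the literal objects of the two budgets.)

* **`abs_srwTwist_prodCosPowSinSq_sub_recurrenceLitObj_le`**, **`abs_srwTwist_prodCosPowSinSqSinSq_sub_recurrenceLitObj_le`**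
  — CONSUMER FORM: the two budgets restated with the kernel-form object (`K·Obj_n(P̃(c′))`) and the `srwI` seed
  (`K′·I_{n+1,0}(x)`), i.e. exactly the inequality a kept-slice certificate cell consumes; nothing but the two
  rewrites above.

## References
* [NoBLE17-I] R. Fitzner, R. van der Hofstad, PTRF 169 (2017) 1041–1119; arXiv:1506.07969 — §3.3.3,
  (3.34)–(3.38) p. 1070–1071; §5.1.1 (5.2)–(5.5) p. 1089–1090; §5.2 (5.9)–(5.10), (5.14) p. 1092.
* [DLMF] NIST Digital Library of Mathematical Functions — 10.29.1 (recurrence), 10.32.1/10.32.3, 10.35.2, 10.37.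
* [Amos1974] D. E. Amos, *Computation of modified Bessel functions and their ratios*, Math. Comp. 28 (1974) 239–251 — (1).
-/

noncomputable section

open MeasureTheory Set Filter Real
open scoped Topology Nat

namespace Literature.Probability.FitznerVanDerHofstad2017

open Literature.Barriers.CriticalPhenomena
open Literature.Barriers.CriticalPhenomena.Slade2006Prop53 (μI P)
open Literature.Probability.LatticeModels (besselI besselI_nonneg besselI_le_besselI_zero
  besselI_recurrence srwHeatKernel continuous_srwHeatKernel_left)
open Literature.Analysis.FunctionSpaces (besselJ)

variable {d : ℕ}

/-! ### Product-object perturbation with general anchors -/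

/-- Monotonicity of the product increment: `Π(x_i+ρ_i) − Π x_i ≤ Π(α_i+ρ_i) − Π α_i` for
`0 ≤ x_i ≤ α_i`, `0 ≤ ρ_i`. [folklore] -/
private theorem prod_add_sub_prod_mono {ι : Type*} (s : Finset ι) (x α ρ : ι → ℝ)
    (hx0 : ∀ i ∈ s, 0 ≤ x i) (hxα : ∀ i ∈ s, x i ≤ α i) (hρ : ∀ i ∈ s, 0 ≤ ρ i) :
    ∏ i ∈ s, (x i + ρ i) - ∏ i ∈ s, x i ≤ ∏ i ∈ s, (α i + ρ i) - ∏ i ∈ s, α i := by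
  classical
  induction s using Finset.induction_on with
  | empty => simp
  | insert j s hj ih =>
    have hx0' : ∀ i ∈ s, 0 ≤ x i := fun i hi => hx0 i (Finset.mem_insert_of_mem hi)
    have hxα' : ∀ i ∈ s, x i ≤ α i := fun i hi => hxα i (Finset.mem_insert_of_mem hi)
    have hρ' : ∀ i ∈ s, 0 ≤ ρ i := fun i hi => hρ i (Finset.mem_insert_of_mem hi)
    have ih' := ih hx0' hxα' hρ'
    have hxj0 : 0 ≤ x j := hx0 j (Finset.mem_insert_self j s)
    have hxjα : x j ≤ α j := hxα j (Finset.mem_insert_self j s)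
    have hρj : 0 ≤ ρ j := hρ j (Finset.mem_insert_self j s)
    rw [Finset.prod_insert hj, Finset.prod_insert hj, Finset.prod_insert hj, Finset.prod_insert hj]
    set Pp := ∏ i ∈ s, (x i + ρ i)
    set P0 := ∏ i ∈ s, x i
    set Ap := ∏ i ∈ s, (α i + ρ i)
    set A0 := ∏ i ∈ s, α i
    have hP0P : P0 ≤ Pp := Finset.prod_le_prod hx0' (fun i hi => by linarith [hρ' i hi])
    have hPpA : Pp ≤ Ap :=
      Finset.prod_le_prod (fun i hi => by linarith [hx0' i hi, hρ' i hi])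
        (fun i hi => by linarith [hxα' i hi])
    have hD0 : 0 ≤ Ap - A0 := (sub_nonneg.2 hP0P).trans ih'
    have e1 : x j * (Pp - P0) ≤ α j * (Ap - A0) :=
      (mul_le_mul_of_nonneg_left ih' hxj0).trans (mul_le_mul_of_nonneg_right hxjα hD0)
    have e2 : ρ j * Pp ≤ ρ j * Ap := mul_le_mul_of_nonneg_left hPpA hρj
    calc (x j + ρ j) * Pp - x j * P0 = x j * (Pp - P0) + ρ j * Pp := by ring
      _ ≤ α j * (Ap - A0) + ρ j * Ap := add_le_add e1 e2
      _ = (α j + ρ j) * Ap - α j * A0 := by ring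

/-- **Product-object perturbation with general anchors.** For continuous rows `R_μ, R′_μ : ℝ → ℂ`,
nonnegative anchors `G_μ(τ)` with `τⁿ e^{−τ} Π_μ G_μ` integrable on `(0,∞)`, and
`‖R′_μ(τ)‖ ≤ α′_μ G_μ(τ)`, `‖R_μ(τ) − R′_μ(τ)‖ ≤ η_μ G_μ(τ)` (`τ > 0`; `α′, η ≥ 0`):
`|Obj_n(R) − Obj_n(R′)| ≤ (Π_μ(α′_μ+η_μ) − Π_μ α′_μ) · Obj_n(G)`,
`Obj_n(R) = (n!)⁻¹ (∫₀^∞ τⁿ e^{−τ} Re Π_μ R_μ(τ) dτ)/(2π)^d`.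
[cite: FitznerVanDerHofstad2016NoBLE, (3.34)–(3.36) p. 1071, §5.1.1 (5.2)–(5.5), §5.2 (5.10) p. 1092] -/
theorem abs_prodRowObj_sub_prodRowObj_le_of_anchor (n : ℕ) (R R' : Fin d → ℝ → ℂ)
    (hR : ∀ μ, Continuous (R μ)) (hR' : ∀ μ, Continuous (R' μ)) (G : Fin d → ℝ → ℝ)
    (hG0 : ∀ μ (τ : ℝ), 0 < τ → 0 ≤ G μ τ)
    (hGi : IntegrableOn (fun τ : ℝ => τ ^ n * (Real.exp (-τ) * ∏ μ, G μ τ)) (Ioi 0))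
    (α' η : Fin d → ℝ) (hα' : ∀ μ, 0 ≤ α' μ) (hη : ∀ μ, 0 ≤ η μ)
    (hb' : ∀ μ (τ : ℝ), 0 < τ → ‖R' μ τ‖ ≤ α' μ * G μ τ)
    (hb : ∀ μ (τ : ℝ), 0 < τ → ‖R μ τ - R' μ τ‖ ≤ η μ * G μ τ) :
    |(n ! : ℝ)⁻¹ * (∫ τ in Ioi (0:ℝ), τ ^ n * (Real.exp (-τ) * (∏ μ, R μ τ).re)) / (2 * π) ^ d
      - (n ! : ℝ)⁻¹ * (∫ τ in Ioi (0:ℝ), τ ^ n * (Real.exp (-τ) * (∏ μ, R' μ τ).re)) / (2 * π) ^ d|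
    ≤ ((∏ μ, (α' μ + η μ)) - ∏ μ, α' μ)
      * ((n ! : ℝ)⁻¹ * (∫ τ in Ioi (0:ℝ), τ ^ n * (Real.exp (-τ) * ∏ μ, G μ τ)) / (2 * π) ^ d) := by
  have hπ : (0 : ℝ) < (2 * π) ^ d := by positivity
  have hn0 : (0 : ℝ) < (n ! : ℝ)⁻¹ := by positivity
  set K : ℝ := (∏ μ, (α' μ + η μ)) - ∏ μ, α' μ with hK
  set f : ℝ → ℝ := fun τ => τ ^ n * (Real.exp (-τ) * (∏ μ, R μ τ).re) with hf
  set g : ℝ → ℝ := fun τ => τ ^ n * (Real.exp (-τ) * (∏ μ, R' μ τ).re) with hg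
  set h : ℝ → ℝ := fun τ => τ ^ n * (Real.exp (-τ) * ∏ μ, G μ τ) with hh
  have hK0 : 0 ≤ K := by
    have : ∏ μ, α' μ ≤ ∏ μ, (α' μ + η μ) :=
      Finset.prod_le_prod (fun μ _ => hα' μ) (fun μ _ => by linarith [hη μ])
    simp only [hK]; linarith
  have hh0 : ∀ τ : ℝ, 0 < τ → 0 ≤ h τ := fun τ hτ =>
    mul_nonneg (pow_nonneg hτ.le n) (mul_nonneg (Real.exp_pos _).le
      (Finset.prod_nonneg fun μ _ => hG0 μ τ hτ))
  -- norms of the products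
  have hPR' : ∀ τ : ℝ, 0 < τ → ‖∏ μ, R' μ τ‖ ≤ (∏ μ, α' μ) * ∏ μ, G μ τ := by
    intro τ hτ
    rw [norm_prod, ← Finset.prod_mul_distrib]
    exact Finset.prod_le_prod (fun μ _ => norm_nonneg _) (fun μ _ => hb' μ τ hτ)
  have hPR : ∀ τ : ℝ, 0 < τ → ‖∏ μ, R μ τ‖ ≤ (∏ μ, (α' μ + η μ)) * ∏ μ, G μ τ := by
    intro τ hτ
    rw [norm_prod, ← Finset.prod_mul_distrib]
    refine Finset.prod_le_prod (fun μ _ => norm_nonneg _) (fun μ _ => ?_)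
    calc ‖R μ τ‖ = ‖R' μ τ + (R μ τ - R' μ τ)‖ := by ring_nf
      _ ≤ ‖R' μ τ‖ + ‖R μ τ - R' μ τ‖ := norm_add_le _ _
      _ ≤ α' μ * G μ τ + η μ * G μ τ := add_le_add (hb' μ τ hτ) (hb μ τ hτ)
      _ = (α' μ + η μ) * G μ τ := by ring
  -- pointwise: |f − g| ≤ K h on (0,∞)
  have hfg_le : ∀ τ : ℝ, 0 < τ → ‖f τ - g τ‖ ≤ K * h τ := by
    intro τ hτ
    have hre : |(∏ μ, R μ τ).re - (∏ μ, R' μ τ).re| ≤ K * ∏ μ, G μ τ := by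
      have h1 := abs_re_prod_add_sub_re_prod_le Finset.univ (fun μ => R' μ τ)
        (fun μ => R μ τ - R' μ τ) (fun μ => η μ * G μ τ) (fun μ _ => hb μ τ hτ)
      simp only [add_sub_cancel] at h1
      refine h1.trans ?_
      have h2 := prod_add_sub_prod_mono Finset.univ (fun μ => ‖R' μ τ‖)
        (fun μ => α' μ * G μ τ) (fun μ => η μ * G μ τ)
        (fun μ _ => norm_nonneg _) (fun μ _ => hb' μ τ hτ) (fun μ _ => mul_nonneg (hη μ) (hG0 μ τ hτ))
      refine h2.trans (le_of_eq ?_)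
      have e3 : ∀ μ, α' μ * G μ τ + η μ * G μ τ = (α' μ + η μ) * G μ τ := fun μ => by ring
      simp_rw [e3]
      rw [Finset.prod_mul_distrib, Finset.prod_mul_distrib, hK]
      ring
    simp only [hf, hg, hh, Real.norm_eq_abs]
    rw [← mul_sub, ← mul_sub, abs_mul, abs_mul, abs_of_nonneg (pow_nonneg hτ.le n),
      abs_of_nonneg (Real.exp_pos _).le]
    calc τ ^ n * (Real.exp (-τ) * |(∏ μ, R μ τ).re - (∏ μ, R' μ τ).re|)
        ≤ τ ^ n * (Real.exp (-τ) * (K * ∏ μ, G μ τ)) := by gcongr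
      _ = K * (τ ^ n * (Real.exp (-τ) * ∏ μ, G μ τ)) := by ring
  -- measurability / integrability
  have hcf : Continuous f := by
    simp only [hf]
    exact (continuous_pow n).mul ((Real.continuous_exp.comp continuous_neg).mul
      (Complex.continuous_re.comp (continuous_finsetProd _ fun μ _ => hR μ)))
  have hcg : Continuous g := by
    simp only [hg]
    exact (continuous_pow n).mul ((Real.continuous_exp.comp continuous_neg).mul
      (Complex.continuous_re.comp (continuous_finsetProd _ fun μ _ => hR' μ)))
  have hgi : IntegrableOn g (Ioi 0) := by
    refine (hGi.const_mul (∏ μ, α' μ)).mono' hcg.aestronglyMeasurable ?_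
    rw [ae_restrict_iff' measurableSet_Ioi]
    refine Eventually.of_forall fun τ (hτ : (0:ℝ) < τ) => ?_
    simp only [hg, Real.norm_eq_abs]
    rw [abs_mul, abs_mul, abs_of_nonneg (pow_nonneg hτ.le n), abs_of_nonneg (Real.exp_pos _).le]
    calc τ ^ n * (Real.exp (-τ) * |(∏ μ, R' μ τ).re|)
        ≤ τ ^ n * (Real.exp (-τ) * ((∏ μ, α' μ) * ∏ μ, G μ τ)) := by
          gcongr
          exact (Complex.abs_re_le_norm _).trans (hPR' τ hτ)
      _ = (∏ μ, α' μ) * (τ ^ n * (Real.exp (-τ) * ∏ μ, G μ τ)) := by ring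
  have hfi : IntegrableOn f (Ioi 0) := by
    refine (hGi.const_mul (∏ μ, (α' μ + η μ))).mono' hcf.aestronglyMeasurable ?_
    rw [ae_restrict_iff' measurableSet_Ioi]
    refine Eventually.of_forall fun τ (hτ : (0:ℝ) < τ) => ?_
    simp only [hf, Real.norm_eq_abs]
    rw [abs_mul, abs_mul, abs_of_nonneg (pow_nonneg hτ.le n), abs_of_nonneg (Real.exp_pos _).le]
    calc τ ^ n * (Real.exp (-τ) * |(∏ μ, R μ τ).re|)
        ≤ τ ^ n * (Real.exp (-τ) * ((∏ μ, (α' μ + η μ)) * ∏ μ, G μ τ)) := by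
          gcongr
          exact (Complex.abs_re_le_norm _).trans (hPR τ hτ)
      _ = (∏ μ, (α' μ + η μ)) * (τ ^ n * (Real.exp (-τ) * ∏ μ, G μ τ)) := by ring
  have hdiff : ‖(∫ τ in Ioi (0:ℝ), f τ) - ∫ τ in Ioi (0:ℝ), g τ‖ ≤ K * ∫ τ in Ioi (0:ℝ), h τ := by
    rw [← integral_sub hfi hgi, ← integral_const_mul]
    refine norm_integral_le_of_norm_le (hGi.const_mul K) ?_
    rw [ae_restrict_iff' measurableSet_Ioi]
    exact Eventually.of_forall fun τ (hτ : (0:ℝ) < τ) => hfg_le τ hτ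
  rw [Real.norm_eq_abs] at hdiff
  have e : (n ! : ℝ)⁻¹ * (∫ τ in Ioi (0:ℝ), f τ) / (2 * π) ^ d
      - (n ! : ℝ)⁻¹ * (∫ τ in Ioi (0:ℝ), g τ) / (2 * π) ^ d
      = (n ! : ℝ)⁻¹ * ((∫ τ in Ioi (0:ℝ), f τ) - ∫ τ in Ioi (0:ℝ), g τ) / (2 * π) ^ d := by ring
  rw [e, abs_div, abs_mul, abs_of_pos hn0, abs_of_pos hπ, mul_div_assoc]
  have hS : (n ! : ℝ)⁻¹ * (|(∫ τ in Ioi (0:ℝ), f τ) - ∫ τ in Ioi (0:ℝ), g τ| / (2 * π) ^ d)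
      ≤ (n ! : ℝ)⁻¹ * ((K * ∫ τ in Ioi (0:ℝ), h τ) / (2 * π) ^ d) := by gcongr
  refine hS.trans (le_of_eq ?_)
  simp only [hh]
  ring

/-! ### The abstract two-piece budget -/

/-- **Two-piece budget of a product of anchored rows.** Rows `T_μ(τ)` with `‖T_μ‖ ≤ A_μ`, folded truncations
`P_μ(c)(τ) = Σ_{j≤J} ε_j W_{μ,j}(τ) c_{μ,j}` with `‖T_μ − P_μ(c)‖ ≤ 2δ A_μ` and `‖W_{μ,j}‖ ≤ A_μ/(2π)`; then for any
second table `c′`: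
`|Obj_n(T) − Obj_n(P(c′))| ≤ [((1+2δ)^d − 1) + (Π_μ(α′_μ+η_μ) − Π_μ α′_μ)/(2π)^d] · Obj_n(A)`,
`α′_μ = Σ_{j≤J} ε_j‖c′_{μ,j}‖`, `η_μ = Σ_{j≤J} ε_j‖c_{μ,j} − c′_{μ,j}‖`.
[cite: FitznerVanDerHofstad2016NoBLE, (3.34)–(3.36) p. 1071, §5.1.1 (5.2)–(5.5), §5.2 (5.10) p. 1092; DLMF, 10.14.4] -/
theorem abs_rowObj_sub_prodTruncObj_le (n : ℕ) (T : Fin d → ℝ → ℂ) (W : Fin d → ℕ → ℝ → ℂ)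
    (A : Fin d → ℝ → ℝ) (hTc : ∀ μ, Continuous (T μ)) (hWc : ∀ μ j, Continuous (W μ j))
    (hA0 : ∀ μ (τ : ℝ), 0 < τ → 0 ≤ A μ τ)
    (hAi : IntegrableOn (fun τ : ℝ => τ ^ n * (Real.exp (-τ) * ∏ μ, A μ τ)) (Ioi 0))
    (J : ℕ) (c c' : Fin d → ℕ → ℂ) {δ : ℝ} (hδ : 0 ≤ δ)
    (hTA : ∀ μ (τ : ℝ), 0 < τ → ‖T μ τ‖ ≤ A μ τ)
    (hball : ∀ μ (τ : ℝ), 0 < τ → ‖T μ τ - ∑ j ∈ Finset.range (J + 1),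
      (if j = 0 then (1 : ℂ) else 2) * (W μ j τ * c μ j)‖ ≤ 2 * δ * A μ τ)
    (hWA : ∀ μ j (τ : ℝ), 0 < τ → ‖W μ j τ‖ ≤ A μ τ / (2 * π)) :
    |(n ! : ℝ)⁻¹ * (∫ τ in Ioi (0:ℝ), τ ^ n * (Real.exp (-τ) * (∏ μ, T μ τ).re)) / (2 * π) ^ d
      - (n ! : ℝ)⁻¹ * (∫ τ in Ioi (0:ℝ), τ ^ n * (Real.exp (-τ) *
        (∏ μ, ∑ j ∈ Finset.range (J + 1), (if j = 0 then (1 : ℂ) else 2) * (W μ j τ * c' μ j)).re))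
        / (2 * π) ^ d|
    ≤ (((1 + 2 * δ) ^ d - 1)
        + ((∏ μ, ((∑ j ∈ Finset.range (J + 1), (if j = 0 then (1 : ℝ) else 2) * ‖c' μ j‖)
            + ∑ j ∈ Finset.range (J + 1), (if j = 0 then (1 : ℝ) else 2) * ‖c μ j - c' μ j‖))
          - ∏ μ, ∑ j ∈ Finset.range (J + 1), (if j = 0 then (1 : ℝ) else 2) * ‖c' μ j‖) / (2 * π) ^ d)
      * ((n ! : ℝ)⁻¹ * (∫ τ in Ioi (0:ℝ), τ ^ n * (Real.exp (-τ) * ∏ μ, A μ τ)) / (2 * π) ^ d) := by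
  have hπ0 : (0 : ℝ) < 2 * π := by positivity
  set P : (Fin d → ℕ → ℂ) → Fin d → ℝ → ℂ := fun cc μ τ =>
    ∑ j ∈ Finset.range (J + 1), (if j = 0 then (1 : ℂ) else 2) * (W μ j τ * cc μ j) with hP
  set S : ℝ := (n ! : ℝ)⁻¹ * (∫ τ in Ioi (0:ℝ), τ ^ n * (Real.exp (-τ) * ∏ μ, A μ τ)) / (2 * π) ^ d
    with hS
  have hε0 : ∀ j : ℕ, (0 : ℝ) ≤ (if j = 0 then (1 : ℝ) else 2) := fun j => by split_ifs <;> norm_num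
  have hεn : ∀ j : ℕ, ‖(if j = 0 then (1 : ℂ) else 2)‖ = (if j = 0 then (1 : ℝ) else 2) := fun j => by
    split_ifs <;> simp
  have hPc : ∀ cc μ, Continuous (P cc μ) := fun cc μ => by
    simp only [hP]
    exact continuous_finsetSum _ fun j _ => continuous_const.mul ((hWc μ j).mul continuous_const)
  -- norm of a folded truncation against the anchor
  have hPn : ∀ (cc : Fin d → ℕ → ℂ) μ (τ : ℝ), 0 < τ →
      ‖P cc μ τ‖ ≤ ((∑ j ∈ Finset.range (J + 1), (if j = 0 then (1 : ℝ) else 2) * ‖cc μ j‖) / (2 * π))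
        * A μ τ := by
    intro cc μ τ hτ
    simp only [hP]
    refine (norm_sum_le _ _).trans ?_
    rw [Finset.sum_div, Finset.sum_mul]
    refine Finset.sum_le_sum fun j _ => ?_
    rw [norm_mul, norm_mul, hεn]
    calc (if j = 0 then (1 : ℝ) else 2) * (‖W μ j τ‖ * ‖cc μ j‖)
        ≤ (if j = 0 then (1 : ℝ) else 2) * (A μ τ / (2 * π) * ‖cc μ j‖) := by
          gcongr
          exact hWA μ j τ hτ
      _ = (if j = 0 then (1 : ℝ) else 2) * ‖cc μ j‖ / (2 * π) * A μ τ := by ring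
  -- piece 1: truncation, anchors A, coefficients (1, 2δ)
  have h1 := abs_prodRowObj_sub_prodRowObj_le_of_anchor n (P c) T (hPc c) hTc A hA0 hAi
    (fun _ => 1) (fun _ => 2 * δ) (fun _ => zero_le_one) (fun _ => by positivity)
    (fun μ τ hτ => by rw [one_mul]; exact hTA μ τ hτ)
    (fun μ τ hτ => by rw [norm_sub_rev]; exact hball μ τ hτ)
  -- piece 2: coefficient substitution, anchors A, coefficients (α′/(2π), η/(2π))
  have h2 := abs_prodRowObj_sub_prodRowObj_le_of_anchor n (P c) (P c') (hPc c) (hPc c') A hA0 hAi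
    (fun μ => (∑ j ∈ Finset.range (J + 1), (if j = 0 then (1 : ℝ) else 2) * ‖c' μ j‖) / (2 * π))
    (fun μ => (∑ j ∈ Finset.range (J + 1), (if j = 0 then (1 : ℝ) else 2) * ‖c μ j - c' μ j‖) / (2 * π))
    (fun μ => div_nonneg (Finset.sum_nonneg fun j _ => mul_nonneg (hε0 j) (norm_nonneg _)) hπ0.le)
    (fun μ => div_nonneg (Finset.sum_nonneg fun j _ => mul_nonneg (hε0 j) (norm_nonneg _)) hπ0.le)
    (fun μ τ hτ => hPn c' μ τ hτ)
    (fun μ τ hτ => by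
      have e : P c μ τ - P c' μ τ = P (fun μ j => c μ j - c' μ j) μ τ := by
        simp only [hP, ← Finset.sum_sub_distrib, ← mul_sub]
      rw [e]
      exact hPn (fun μ j => c μ j - c' μ j) μ τ hτ)
  -- constants
  have e1 : (∏ _μ : Fin d, ((1 : ℝ) + 2 * δ)) - ∏ _μ : Fin d, (1 : ℝ) = (1 + 2 * δ) ^ d - 1 := by
    rw [Finset.prod_const, Finset.prod_const, Finset.card_univ, Fintype.card_fin, one_pow]
  have e2 : (∏ μ, ((∑ j ∈ Finset.range (J + 1), (if j = 0 then (1 : ℝ) else 2) * ‖c' μ j‖) / (2 * π)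
        + (∑ j ∈ Finset.range (J + 1), (if j = 0 then (1 : ℝ) else 2) * ‖c μ j - c' μ j‖) / (2 * π)))
      - ∏ μ, (∑ j ∈ Finset.range (J + 1), (if j = 0 then (1 : ℝ) else 2) * ‖c' μ j‖) / (2 * π)
      = ((∏ μ, ((∑ j ∈ Finset.range (J + 1), (if j = 0 then (1 : ℝ) else 2) * ‖c' μ j‖)
            + ∑ j ∈ Finset.range (J + 1), (if j = 0 then (1 : ℝ) else 2) * ‖c μ j - c' μ j‖))
          - ∏ μ, ∑ j ∈ Finset.range (J + 1), (if j = 0 then (1 : ℝ) else 2) * ‖c' μ j‖)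
        / (2 * π) ^ d := by
    have e3 : ∀ x y : ℝ, x / (2 * π) + y / (2 * π) = (x + y) / (2 * π) := fun x y => by ring
    simp_rw [e3]
    rw [Finset.prod_div_distrib, Finset.prod_div_distrib, Finset.prod_const, Finset.card_univ,
      Fintype.card_fin, sub_div]
  rw [e1] at h1
  rw [e2] at h2
  have h1' := abs_sub_comm ((n ! : ℝ)⁻¹ * (∫ τ in Ioi (0:ℝ), τ ^ n * (Real.exp (-τ) *
      (∏ μ, P c μ τ).re)) / (2 * π) ^ d) ((n ! : ℝ)⁻¹ * (∫ τ in Ioi (0:ℝ), τ ^ n * (Real.exp (-τ) *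
      (∏ μ, T μ τ).re)) / (2 * π) ^ d) ▸ h1
  calc _ ≤ |(n ! : ℝ)⁻¹ * (∫ τ in Ioi (0:ℝ), τ ^ n * (Real.exp (-τ) * (∏ μ, T μ τ).re)) / (2 * π) ^ d
          - (n ! : ℝ)⁻¹ * (∫ τ in Ioi (0:ℝ), τ ^ n * (Real.exp (-τ) * (∏ μ, P c μ τ).re)) / (2 * π) ^ d|
        + |(n ! : ℝ)⁻¹ * (∫ τ in Ioi (0:ℝ), τ ^ n * (Real.exp (-τ) * (∏ μ, P c μ τ).re)) / (2 * π) ^ d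
          - (n ! : ℝ)⁻¹ * (∫ τ in Ioi (0:ℝ), τ ^ n * (Real.exp (-τ) * (∏ μ, P c' μ τ).re))
            / (2 * π) ^ d| := abs_sub_le _ _ _
    _ ≤ ((1 + 2 * δ) ^ d - 1) * S
        + ((∏ μ, ((∑ j ∈ Finset.range (J + 1), (if j = 0 then (1 : ℝ) else 2) * ‖c' μ j‖)
            + ∑ j ∈ Finset.range (J + 1), (if j = 0 then (1 : ℝ) else 2) * ‖c μ j - c' μ j‖))
          - ∏ μ, ∑ j ∈ Finset.range (J + 1), (if j = 0 then (1 : ℝ) else 2) * ‖c' μ j‖)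
        / (2 * π) ^ d * S := add_le_add h1' h2
    _ = _ := by simp only [hS]; ring


/-! ### The kept anchor: decay and integrability -/

/-- `(I_0 − I_2)(v) = 2 I_1(v)/v ≤ 2 I_0(v)/v` for `v > 0` (three-term recurrence, `I_1 ≤ I_0`).
[cite: DLMF, 10.29.1; Amos1974, (1) p. 239] -/
theorem besselI_zero_sub_two_le_div {v : ℝ} (hv : 0 < v) :
    besselI 0 v - besselI 2 v ≤ 2 * besselI 0 v / v := by
  have h := besselI_recurrence 0 v
  push_cast at h
  simp only [zero_add] at h
  norm_num at h
  have h1 : besselI 1 v ≤ besselI 0 v := besselI_le_besselI_zero hv.le 1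
  rw [le_div_iff₀ hv]
  nlinarith

/-- `0 ≤ (I_0 − I_2)(v)` for `v ≥ 0` (`I_2 ≤ I_0`). [cite: DLMF, 10.37] -/
theorem besselI_zero_sub_two_nonneg {v : ℝ} (hv : 0 ≤ v) : 0 ≤ besselI 0 v - besselI 2 v :=
  sub_nonneg.2 (besselI_le_besselI_zero hv 2)

/-- Continuity of `τ ↦ I_b(τ/d)`. [folklore] -/
private theorem continuous_besselI_div (b : ℤ) : Continuous fun τ : ℝ => besselI b (τ / d) := by
  have e : (fun τ : ℝ => besselI b (τ / d))
      = fun τ => Real.exp (τ / d) * srwHeatKernel (τ / d) b := by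
    ext τ
    rw [srwHeatKernel_eq_exp_neg_mul_besselI, ← mul_assoc, ← Real.exp_add, add_neg_cancel,
      Real.exp_zero, one_mul]
  rw [e]
  exact ((Real.continuous_exp.comp (continuous_id.div_const _))).mul
    ((continuous_srwHeatKernel_left b).comp (continuous_id.div_const _))

/-- The one-kept anchor product: `Π_μ A_μ = π(I_0 − I_2)(v) · (2π I_0(v))^{d−1}` (`A_{j₀}` kept, the rest plain).
[folklore] -/
private theorem prod_keptAnchor_eq (j0 : Fin d) (v : ℝ) :
    ∏ μ : Fin d, (if μ = j0 then π * (besselI 0 v - besselI 2 v) else 2 * π * besselI 0 v)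
      = π * (besselI 0 v - besselI 2 v) * (2 * π * besselI 0 v) ^ (d - 1) := by
  rw [← Finset.mul_prod_erase Finset.univ _ (Finset.mem_univ j0), if_pos rfl]
  congr 1
  rw [Finset.prod_congr rfl (fun μ hμ => if_neg (Finset.ne_of_mem_erase hμ)), Finset.prod_const,
    Finset.card_erase_of_mem (Finset.mem_univ j0), Finset.card_univ, Fintype.card_fin]

/-- **Integrability of the one-kept anchor product in the sharp range.** For `d ≥ 2n+3`,
`τ ↦ τ^{n+1} e^{−τ} · π(I_0 − I_2)(τ/d) · (2π I_0(τ/d))^{d−1}` is integrable on `(0,∞)`: by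
`(I_0 − I_2)(v) ≤ 2I_0(v)/v` it is dominated by `d (2π)^d · τⁿ q_{τ/d}(0)^d`, the origin seed's integrand one
index LOWER (`integrableOn_pow_mul_srwHeatKernel_zero_pow`) — the kept `sin²` buys exactly one `Ĉ`-power.
[cite: FitznerVanDerHofstad2016NoBLE, §5.1.1 (5.2)–(5.4), §5.2 (5.10) p. 1092; DLMF, 10.29.1] -/
theorem integrableOn_pow_succ_mul_exp_neg_mul_prod_keptAnchor (n : ℕ) (hd : 2 * n + 3 ≤ d)
    (j0 : Fin d) :
    IntegrableOn (fun τ : ℝ => τ ^ (n + 1) * (Real.exp (-τ) * ∏ μ : Fin d,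
      (if μ = j0 then π * (besselI 0 (τ / d) - besselI 2 (τ / d))
        else 2 * π * besselI 0 (τ / d)))) (Ioi 0) := by
  have hd1 : 1 ≤ d := by omega
  have hd0 : (0 : ℝ) < d := by exact_mod_cast (by omega : 0 < d)
  have hdne : (d : ℝ) ≠ 0 := hd0.ne'
  simp_rw [prod_keptAnchor_eq j0]
  have hcont : Continuous (fun τ : ℝ => τ ^ (n + 1) * (Real.exp (-τ)
      * (π * (besselI 0 (τ / d) - besselI 2 (τ / d)) * (2 * π * besselI 0 (τ / d)) ^ (d - 1)))) :=
    (continuous_pow (n + 1)).mul ((Real.continuous_exp.comp continuous_neg).mul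
      ((continuous_const.mul ((continuous_besselI_div 0).sub (continuous_besselI_div 2))).mul
        ((continuous_const.mul (continuous_besselI_div 0)).pow _)))
  refine ((integrableOn_pow_mul_srwHeatKernel_zero_pow n hd).const_mul
    ((d : ℝ) * (2 * π) ^ d)).mono' hcont.aestronglyMeasurable ?_
  rw [ae_restrict_iff' measurableSet_Ioi]
  refine Eventually.of_forall fun τ (hτ : (0:ℝ) < τ) => ?_
  have hv : 0 < τ / d := by positivity
  have hI0 : 0 ≤ besselI 0 (τ / d) := besselI_nonneg hv.le 0
  have hK0 : 0 ≤ besselI 0 (τ / d) - besselI 2 (τ / d) := besselI_zero_sub_two_nonneg hv.le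
  have hK : besselI 0 (τ / d) - besselI 2 (τ / d) ≤ 2 * besselI 0 (τ / d) / (τ / d) :=
    besselI_zero_sub_two_le_div hv
  have hq : Real.exp (-τ) * besselI 0 (τ / d) ^ d = srwHeatKernel (τ / d) 0 ^ d := by
    rw [srwHeatKernel_eq_exp_neg_mul_besselI, mul_pow, ← Real.exp_nat_mul]
    congr 2
    field_simp
  rw [Real.norm_eq_abs, abs_of_nonneg (by positivity)]
  -- τ^{n+1} e^{-τ} π(I₀−I₂) (2πI₀)^{d-1} ≤ τ^{n+1} e^{-τ} (2π I₀ d/τ) (2πI₀)^{d-1} = d (2π)^d τ^n q^d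
  have h2 : π * (besselI 0 (τ / d) - besselI 2 (τ / d)) ≤ 2 * π * besselI 0 (τ / d) * (d / τ) := by
    have : 2 * besselI 0 (τ / d) / (τ / d) = 2 * besselI 0 (τ / d) * (d / τ) := by
      field_simp
    nlinarith [Real.pi_pos, hK, this]
  calc τ ^ (n + 1) * (Real.exp (-τ) * (π * (besselI 0 (τ / d) - besselI 2 (τ / d))
        * (2 * π * besselI 0 (τ / d)) ^ (d - 1)))
      ≤ τ ^ (n + 1) * (Real.exp (-τ) * (2 * π * besselI 0 (τ / d) * (d / τ)
        * (2 * π * besselI 0 (τ / d)) ^ (d - 1))) := by gcongr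
    _ = (d : ℝ) * (2 * π) ^ d * (τ ^ n * (Real.exp (-τ) * besselI 0 (τ / d) ^ d)) := by
        have e' : (2 * π * besselI 0 (τ / d)) * (2 * π * besselI 0 (τ / d)) ^ (d - 1)
            = (2 * π) ^ d * besselI 0 (τ / d) ^ d := by
          rw [← pow_succ', Nat.sub_add_cancel hd1, mul_pow]
        have e'' : τ * ((d : ℝ) / τ) = d := by field_simp
        calc τ ^ (n + 1) * (Real.exp (-τ) * (2 * π * besselI 0 (τ / d) * (d / τ)
              * (2 * π * besselI 0 (τ / d)) ^ (d - 1)))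
            = τ ^ n * (τ * ((d : ℝ) / τ)) * (Real.exp (-τ)
              * ((2 * π * besselI 0 (τ / d)) * (2 * π * besselI 0 (τ / d)) ^ (d - 1))) := by ring
          _ = τ ^ n * (d : ℝ) * (Real.exp (-τ) * ((2 * π) ^ d * besselI 0 (τ / d) ^ d)) := by
              rw [e', e'']
          _ = (d : ℝ) * (2 * π) ^ d * (τ ^ n * (Real.exp (-τ) * besselI 0 (τ / d) ^ d)) := by ring
    _ = (d : ℝ) * (2 * π) ^ d * (τ ^ n * srwHeatKernel (τ / d) 0 ^ d) := by rw [hq]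

/-! ### Rows: continuity, and the kept seed as a Schwinger integral -/

/-- Continuity in the Schwinger parameter of a weighted row `τ ↦ ∫ g(t) e^{(τ/d) cos t + iy cos(mt)} dt`. [folklore] -/
private theorem continuous_weightRow (g : ℝ → ℝ) (hg : Continuous g) (y : ℝ) (m : ℤ) :
    Continuous fun τ : ℝ => ∫ t, (g t : ℂ) * Complex.exp (((τ / d * Real.cos t : ℝ) : ℂ)
      + ((y * Real.cos (m * t) : ℝ) : ℂ) * Complex.I) ∂μI := by
  have hF : Continuous (Function.uncurry fun (τ : ℝ) (t : ℝ) => (g t : ℂ)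
      * Complex.exp (((τ / d * Real.cos t : ℝ) : ℂ) + ((y * Real.cos (m * t) : ℝ) : ℂ) * Complex.I)) := by
    have hg2 : Continuous fun p : ℝ × ℝ => g p.2 := hg.comp continuous_snd
    show Continuous fun p : ℝ × ℝ => (g p.2 : ℂ)
      * Complex.exp (((p.1 / d * Real.cos p.2 : ℝ) : ℂ) + ((y * Real.cos (m * p.2) : ℝ) : ℂ) * Complex.I)
    fun_prop
  exact continuous_parametric_integral_of_continuous hF isCompact_Icc

/-- Continuity in `τ` of the cos-power row weights `W^{(a)}_j(τ/d)`. [folklore] -/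
private theorem continuous_cosPowWeight (a : ℕ) (m j : ℤ) :
    Continuous fun τ : ℝ => ∑ s ∈ Finset.range (a + 1),
      ((a.choose s : ℂ) / 2 ^ a) * (besselI (j * m - ((2 * (s : ℤ) - a : ℤ))) (τ / d) : ℂ) :=
  continuous_finsetSum _ fun _ _ =>
    continuous_const.mul (Complex.continuous_ofReal.comp (continuous_besselI_div _))

/-- **The kept seed as a Schwinger integral of the anchor product**: for `d ≥ 2n+1`,
`Tw_{n+1}[sin²(k_{j₀})](0; 0) = (n!)⁻¹ ∫₀^∞ τⁿ e^{−τ} · π(I_0−I_2)(τ/d) (2πI_0(τ/d))^{d−1} dτ / (2π)^d`.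
[cite: FitznerVanDerHofstad2016NoBLE, §5.1.1 (5.2)–(5.4), §5.2 (5.10) p. 1092; DLMF, 10.32.1, 10.32.3] -/
theorem srwTwist_sinSq_zero_eq_integral_keptAnchor (n : ℕ) (hd : 2 * n + 1 ≤ d) (j0 : Fin d) :
    srwTwist d (n + 1) (fun k => Real.sin (k j0) ^ 2) 0 0
      = (n ! : ℝ)⁻¹ * (∫ τ in Ioi (0:ℝ), τ ^ n * (Real.exp (-τ) * ∏ μ : Fin d,
          (if μ = j0 then π * (besselI 0 (τ / d) - besselI 2 (τ / d))
            else 2 * π * besselI 0 (τ / d)))) / (2 * π) ^ d := by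
  set g : Fin d → ℝ → ℝ := fun μ t => if μ = j0 then Real.sin t ^ 2 else 1 with hg
  have hgc : ∀ μ, Continuous (g μ) := fun μ => by
    simp only [hg]; split_ifs <;> fun_prop
  have hg1 : ∀ μ t, |g μ t| ≤ 1 := fun μ t => by
    simp only [hg]
    split_ifs
    · rw [abs_of_nonneg (sq_nonneg _), Real.sin_sq]; nlinarith [sq_nonneg (Real.cos t)]
    · simp
  have hw : (fun k : Fin d → ℝ => Real.sin (k j0) ^ 2) = fun k => ∏ μ, g μ (k μ) := by
    funext k
    simp only [hg]
    rw [Finset.prod_ite_eq']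
    simp
  have hint : Integrable (fun k => ((∏ μ, g μ (k μ)) * Real.cos (0 * DhatSym d (Pi.single j0 (0:ℤ)) k))
      * Chat d 1 k ^ (n + 1)) (P d) := by
    refine (integrable_weight_sin_sq_cos_mul_Chat_pow_succ hd (w := fun _ => (1:ℝ)) measurable_const
      (W := 1) (fun k => by simp) j0 (Pi.single j0 (0:ℤ)) 0).congr (ae_of_all _ fun k => ?_)
    simp only [one_mul]
    rw [congrFun hw k]
  have h := srwTwist_succ_prod_single_eq_integral_of_integrable n j0 0 0 g hgc hg1 hint
  rw [← hw, Pi.single_zero] at h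
  rw [h]
  congr 2
  refine setIntegral_congr_fun measurableSet_Ioi fun τ _ => ?_
  congr 2
  -- the rows at `m = 0`, `β = 0` are the real anchors
  have hrow : ∀ μ, (∫ t, (g μ t : ℂ) * Complex.exp (((τ / d * Real.cos t : ℝ) : ℂ)
      + (((0:ℝ) / d * Real.cos ((0:ℤ) * t) : ℝ) : ℂ) * Complex.I) ∂μI)
      = ((if μ = j0 then π * (besselI 0 (τ / d) - besselI 2 (τ / d))
          else 2 * π * besselI 0 (τ / d) : ℝ) : ℂ) := by
    intro μ
    have e1 : (fun t : ℝ => (g μ t : ℂ) * Complex.exp (((τ / d * Real.cos t : ℝ) : ℂ)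
        + (((0:ℝ) / d * Real.cos ((0:ℤ) * t) : ℝ) : ℂ) * Complex.I))
        = fun t => (((g μ t * Real.exp (τ / d * Real.cos t)) : ℝ) : ℂ) := by
      funext t
      simp only [zero_div, zero_mul, Complex.ofReal_zero, add_zero]
      push_cast
      ring
    rw [e1, integral_complex_ofReal]
    congr 1
    simp only [hg]
    split_ifs
    · exact integral_sin_sq_mul_exp_mul_cos_μI (τ / d)
    · simp_rw [one_mul]; exact integral_exp_mul_cos_μI (τ / d)
  simp_rw [hrow]
  rw [← Complex.ofReal_prod, Complex.ofReal_re]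

/-! ### The kept-slice budget -/

/-- **Truncation + literal-substitution budget of a ONE-KEPT slice, one-seed form.** For `d ≥ 2n+3`,
`m ≠ 0`, exponents `a : Fin d → ℕ`, a kept `sin²` at `j₀`, truncation order `J` and ANY literal table `c′`:
`|Tw_{n+2}[Π_μ cos^{a_μ}(k_μ) sin²(k_{j₀})](m e_i; β) − ((n+1)!)⁻¹ ∫₀^∞ τ^{n+1} e^{−τ} Re Π_μ P_μ(c′)(τ) dτ/(2π)^d|`
`≤ [((1 + 2δ_J(β/d))^d − 1) + (Π_μ(α′_μ+η_μ) − Π_μ α′_μ)/(2π)^d] · Tw_{n+2}[sin²(k_{j₀})](0; 0)`,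
where `P_μ(c′)(τ) = Σ_{j≤J} ε_j W_{μ,j}(τ/d) c′_{μ,j}` with `W_{μ,j} = W^{(a_μ)}_j − W^{(a_μ+2)}_j` at `μ = j₀` and
`W^{(a_μ)}_j` elsewhere (`W^{(a)}_j(v) = 2^{-a} Σ_s C(a,s) I_{jm−(2s−a)}(v)`), `δ_J(y) = Σ_{l≥0}|J_{l+J+1}(y)|`,
`α′_μ = Σ_{j≤J} ε_j ‖c′_{μ,j}‖`, `η_μ = Σ_{j≤J} ε_j ‖2π iʲ J_j(β/d) − c′_{μ,j}‖`.  With exact literals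
`c′ = c` the second term vanishes; the kept seed is finite exactly in this range
(`integrableOn_pow_succ_mul_exp_neg_mul_prod_keptAnchor`).
[cite: FitznerVanDerHofstad2016NoBLE, (3.34)–(3.38) p. 1071, §5.1.1 (5.2)–(5.5), §5.2 (5.9)–(5.10) p. 1092; DLMF, 10.35.2, 10.14.4, 10.29.1] -/
theorem abs_srwTwist_prodCosPowSinSq_sub_prodRowObj_le (n : ℕ) (hd : 2 * n + 3 ≤ d) (i j0 : Fin d)
    {m : ℤ} (hm : m ≠ 0) (β : ℝ) (a : Fin d → ℕ) (J : ℕ) (c' : Fin d → ℕ → ℂ) :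
    |srwTwist d (n + 2) (fun k => ∏ μ, Real.cos (k μ) ^ a μ
        * (if μ = j0 then Real.sin (k μ) ^ 2 else 1)) (Pi.single i m) β
      - ((n + 1) ! : ℝ)⁻¹ * (∫ τ in Ioi (0:ℝ), τ ^ (n + 1) * (Real.exp (-τ) *
        (∏ μ, ∑ j ∈ Finset.range (J + 1), (if j = 0 then (1 : ℂ) else 2)
          * ((if μ = j0 then
              ((∑ s ∈ Finset.range (a μ + 1), (((a μ).choose s : ℂ) / 2 ^ (a μ))
                  * (besselI (j * m - ((2 * (s : ℤ) - (a μ : ℕ) : ℤ))) (τ / d) : ℂ))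
                - ∑ s ∈ Finset.range (a μ + 2 + 1), (((a μ + 2).choose s : ℂ) / 2 ^ (a μ + 2))
                  * (besselI (j * m - ((2 * (s : ℤ) - (a μ + 2 : ℕ) : ℤ))) (τ / d) : ℂ))
             else
              ∑ s ∈ Finset.range (a μ + 1), (((a μ).choose s : ℂ) / 2 ^ (a μ))
                  * (besselI (j * m - ((2 * (s : ℤ) - (a μ : ℕ) : ℤ))) (τ / d) : ℂ))
            * c' μ j)).re)) / (2 * π) ^ d|
    ≤ (((1 + 2 * ∑' l : ℕ, |besselJ (l + J + 1) (β / d)|) ^ d - 1)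
        + ((∏ μ, ((∑ j ∈ Finset.range (J + 1), (if j = 0 then (1 : ℝ) else 2) * ‖c' μ j‖)
            + ∑ j ∈ Finset.range (J + 1), (if j = 0 then (1 : ℝ) else 2)
              * ‖2 * π * Complex.I ^ j * (besselJ j (β / d) : ℂ) - c' μ j‖))
          - ∏ μ, ∑ j ∈ Finset.range (J + 1), (if j = 0 then (1 : ℝ) else 2) * ‖c' μ j‖) / (2 * π) ^ d)
      * srwTwist d (n + 2) (fun k => Real.sin (k j0) ^ 2) 0 0 := by
  have hd' : 2 * (n + 1) + 1 ≤ d := by omega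
  have hd0 : (0 : ℝ) < d := by exact_mod_cast (by omega : 0 < d)
  have hπ0 : (0 : ℝ) < 2 * π := by positivity
  -- the objects of the abstract budget
  set g : Fin d → ℝ → ℝ := fun μ t => Real.cos t ^ a μ * (if μ = j0 then Real.sin t ^ 2 else 1) with hg
  set T : Fin d → ℝ → ℂ := fun μ τ => ∫ t, (g μ t : ℂ) * Complex.exp (((τ / d * Real.cos t : ℝ) : ℂ)
      + ((β / d * Real.cos (m * t) : ℝ) : ℂ) * Complex.I) ∂μI with hT
  set Wa : ℕ → ℕ → ℝ → ℂ := fun b j τ => ∑ s ∈ Finset.range (b + 1), ((b.choose s : ℂ) / 2 ^ b)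
      * (besselI (j * m - ((2 * (s : ℤ) - (b : ℕ) : ℤ))) (τ / d) : ℂ) with hWa
  set W : Fin d → ℕ → ℝ → ℂ := fun μ j τ =>
    if μ = j0 then Wa (a μ) j τ - Wa (a μ + 2) j τ else Wa (a μ) j τ with hW
  set A : Fin d → ℝ → ℝ := fun μ τ =>
    if μ = j0 then π * (besselI 0 (τ / d) - besselI 2 (τ / d)) else 2 * π * besselI 0 (τ / d) with hA
  set c : Fin d → ℕ → ℂ := fun _ j => 2 * π * Complex.I ^ j * (besselJ j (β / d) : ℂ) with hc
  set δ : ℝ := ∑' l : ℕ, |besselJ (l + J + 1) (β / d)| with hδ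
  have hδ0 : 0 ≤ δ := tsum_nonneg fun l => abs_nonneg _
  -- continuity
  have hgc : ∀ μ, Continuous (g μ) := fun μ => by
    simp only [hg]; split_ifs <;> fun_prop
  have hg1 : ∀ μ t, |g μ t| ≤ 1 := fun μ t => by
    simp only [hg]
    rw [abs_mul, abs_pow]
    refine mul_le_one₀ (pow_le_one₀ (abs_nonneg _) (abs_cos_le_one t)) (abs_nonneg _) ?_
    split_ifs
    · rw [abs_of_nonneg (sq_nonneg _), Real.sin_sq]; nlinarith [sq_nonneg (Real.cos t)]
    · simp
  have hTc : ∀ μ, Continuous (T μ) := fun μ => continuous_weightRow (g μ) (hgc μ) (β / d) m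
  have hWac : ∀ b j, Continuous (Wa b j) := fun b j => continuous_cosPowWeight b m j
  have hWc : ∀ μ j, Continuous (W μ j) := fun μ j => by
    simp only [hW]; split_ifs
    · exact (hWac _ _).sub (hWac _ _)
    · exact hWac _ _
  have hA0 : ∀ μ (τ : ℝ), 0 < τ → 0 ≤ A μ τ := fun μ τ hτ => by
    have hv : 0 ≤ τ / d := by positivity
    simp only [hA]; split_ifs
    · exact mul_nonneg Real.pi_pos.le (besselI_zero_sub_two_nonneg hv)
    · exact mul_nonneg hπ0.le (besselI_nonneg hv 0)
  have hAi : IntegrableOn (fun τ : ℝ => τ ^ (n + 1) * (Real.exp (-τ) * ∏ μ, A μ τ)) (Ioi 0) :=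
    integrableOn_pow_succ_mul_exp_neg_mul_prod_keptAnchor n hd j0
  -- the three row estimates
  have hTA : ∀ μ (τ : ℝ), 0 < τ → ‖T μ τ‖ ≤ A μ τ := fun μ τ hτ => by
    simp only [hT, hA, hg]
    by_cases hμ : μ = j0
    · simp only [hμ, if_true]
      exact norm_cosPowSinSqRow_μI_le (a j0) (τ / d) (β / d) m
    · simp only [hμ, if_false, mul_one]
      exact norm_cosPowRow_μI_le (a μ) (τ / d) (β / d) m
  have hball : ∀ μ (τ : ℝ), 0 < τ → ‖T μ τ - ∑ j ∈ Finset.range (J + 1),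
      (if j = 0 then (1 : ℂ) else 2) * (W μ j τ * c μ j)‖ ≤ 2 * δ * A μ τ := fun μ τ hτ => by
    have hv : 0 ≤ τ / d := by positivity
    simp only [hT, hW, hA, hc, hg, hWa]
    by_cases hμ : μ = j0
    · simp only [hμ, if_true]
      have h := norm_cosPowSinSqRow_sub_foldTrunc_le (τ / d) (β / d) hm (a j0) J
      calc _ ≤ 2 * π * (besselI 0 (τ / d) - besselI 2 (τ / d)) * δ := h
        _ = 2 * δ * (π * (besselI 0 (τ / d) - besselI 2 (τ / d))) := by ring
    · simp only [hμ, if_false, mul_one]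
      have h := norm_sub_foldTrunc_le_of_hasSum_of_norm_le (β / d)
        (hasSum_cos_pow_besselRow_μI (a μ) (τ / d) (β / d) hm)
        (fun k => cosPowWeight_neg (a μ) (τ / d) m k)
        (fun j => norm_cosPowWeight_le_besselI_zero (a μ) hv m j) J
      calc _ ≤ 2 * (2 * π * besselI 0 (τ / d)) * δ := h
        _ = 2 * δ * (2 * π * besselI 0 (τ / d)) := by ring
  have hWA : ∀ μ j (τ : ℝ), 0 < τ → ‖W μ j τ‖ ≤ A μ τ / (2 * π) := fun μ j τ hτ => by
    have hv : 0 ≤ τ / d := by positivity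
    simp only [hW, hA, hWa]
    by_cases hμ : μ = j0
    · simp only [hμ, if_true]
      have h := norm_cosPowWeight_sub_le (a j0) (τ / d) m j
      calc _ ≤ (besselI 0 (τ / d) - besselI 2 (τ / d)) / 2 := h
        _ = π * (besselI 0 (τ / d) - besselI 2 (τ / d)) / (2 * π) := by field_simp
    · simp only [hμ, if_false]
      have h := norm_cosPowWeight_le_besselI_zero (a μ) hv m j
      calc _ ≤ besselI 0 (τ / d) := h
        _ = 2 * π * besselI 0 (τ / d) / (2 * π) := by field_simp
  -- the abstract budget
  have hB := abs_rowObj_sub_prodTruncObj_le (n + 1) T W A hTc hWc hA0 hAi J c c' hδ0 hTA hball hWA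
  -- the true object is the slice; the anchor object is the kept seed
  have hint : Integrable (fun k => ((∏ μ, g μ (k μ)) * Real.cos (β * DhatSym d (Pi.single i m) k))
      * Chat d 1 k ^ (n + 1 + 1)) (P d) :=
    integrable_prodCosPow_sin_sq_cos_mul_Chat_pow_succ hd' a j0 (Pi.single i m) β
  have e1 := srwTwist_succ_prod_single_eq_integral_of_integrable (n + 1) i m β g hgc hg1 hint
  have e2 := srwTwist_sinSq_zero_eq_integral_keptAnchor (n + 1) hd' j0
  rw [show n + 2 = n + 1 + 1 from rfl, e1, e2]
  exact hB


/-! ### Two kept factors: the `sin² sin²` (`j₀ ≠ j₁`) and `sin⁴` (`j₀ = j₁`) anchors -/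

/-- `3I_0 − 4I_2 + I_4 = 24 I_2/v²` for `v ≠ 0` (the three-term recurrence at orders `0, 1, 2`).
[cite: DLMF, 10.29.1; Amos1974, (1) p. 239] -/
theorem three_besselI_zero_sub_add_eq_div_sq {v : ℝ} (hv : v ≠ 0) :
    3 * besselI 0 v - 4 * besselI 2 v + besselI 4 v = 24 * besselI 2 v / v ^ 2 := by
  have h0 := besselI_recurrence 0 v
  have h1 := besselI_recurrence 1 v
  have h2 := besselI_recurrence 2 v
  push_cast at h0 h1 h2
  norm_num at h0 h1 h2
  rw [eq_div_iff (pow_ne_zero 2 hv)]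
  linear_combination (3 * v) * h0 + 6 * h1 - v * h2

/-- The `sin⁴` anchor decays like `1/v²`: `(π/4)(3I_0 − 4I_2 + I_4)(v) = 6π I_2(v)/v² ≤ 2π I_0(v) · (3/v²)`
for `v > 0`. [cite: DLMF, 10.29.1, 10.37] -/
theorem sinFour_anchor_le {v : ℝ} (hv : 0 < v) :
    π / 4 * (3 * besselI 0 v - 4 * besselI 2 v + besselI 4 v) ≤ 2 * π * besselI 0 v * (3 / v ^ 2) := by
  rw [three_besselI_zero_sub_add_eq_div_sq hv.ne']
  have h2 : besselI 2 v ≤ besselI 0 v := besselI_le_besselI_zero hv.le 2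
  rw [show π / 4 * (24 * besselI 2 v / v ^ 2) = 6 * π * (besselI 2 v / v ^ 2) by ring,
    show 2 * π * besselI 0 v * (3 / v ^ 2) = 6 * π * (besselI 0 v / v ^ 2) by ring]
  gcongr

/-- `0 ≤ (π/4)(3I_0 − 4I_2 + I_4)(v)`: it is `∫ sin²t sin²t e^{v cos t} dt`. [cite: DLMF, 10.32.3] -/
theorem sinFour_anchor_nonneg (v : ℝ) : 0 ≤ π / 4 * (3 * besselI 0 v - 4 * besselI 2 v + besselI 4 v) := by
  rw [← integral_sin_sq_mul_sin_sq_mul_exp_mul_cos_μI v]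
  exact integral_nonneg fun t => by positivity

/-- `‖∫ g G e^{v cos t + iy cos(mt)} dt‖ ≤ ∫ G e^{v cos t} dt` for `|g| ≤ 1` and a continuous `G ≥ 0`. [folklore] -/
private theorem norm_weightRow_mul_μI_le (g G : ℝ → ℝ) (hg1 : ∀ t, |g t| ≤ 1) (hG0 : ∀ t, 0 ≤ G t)
    (hGc : Continuous G) (v y : ℝ) (m : ℤ) :
    ‖∫ t, ((g t * G t : ℝ) : ℂ)
        * Complex.exp (((v * Real.cos t : ℝ) : ℂ) + ((y * Real.cos (m * t) : ℝ) : ℂ) * Complex.I) ∂μI‖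
      ≤ ∫ t, G t * Real.exp (v * Real.cos t) ∂μI := by
  have hE : ∀ t : ℝ, ‖Complex.exp (((v * Real.cos t : ℝ) : ℂ)
      + ((y * Real.cos (m * t) : ℝ) : ℂ) * Complex.I)‖ = Real.exp (v * Real.cos t) := by
    intro t
    rw [Complex.norm_exp, Complex.add_re, Complex.ofReal_re, Complex.mul_I_re, Complex.ofReal_im,
      neg_zero, add_zero]
  have hptw : ∀ t : ℝ, ‖((g t * G t : ℝ) : ℂ)
      * Complex.exp (((v * Real.cos t : ℝ) : ℂ) + ((y * Real.cos (m * t) : ℝ) : ℂ) * Complex.I)‖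
      ≤ G t * Real.exp (v * Real.cos t) := by
    intro t
    rw [norm_mul, hE, Complex.norm_real, Real.norm_eq_abs, abs_mul, abs_of_nonneg (hG0 t)]
    exact mul_le_mul_of_nonneg_right (mul_le_of_le_one_left (hG0 t) (hg1 t)) (Real.exp_pos _).le
  have hint : Integrable (fun t : ℝ => G t * Real.exp (v * Real.cos t)) μI := by
    have hc : Continuous (fun t : ℝ => G t * Real.exp (v * Real.cos t)) := by fun_prop
    exact hc.continuousOn.integrableOn_compact isCompact_Icc
  exact norm_integral_le_of_norm_le hint (ae_of_all _ hptw)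

/-- The `cos^a sin⁴` row is anchored at `(π/4)(3I_0 − 4I_2 + I_4)(v)`:
`‖∫ cos^a t sin²t sin²t · e^{v cos t + iy cos(mt)} dt‖ ≤ (π/4)(3I_0 − 4I_2 + I_4)(v)`.
[cite: DLMF, 10.32.3; FitznerVanDerHofstad2016NoBLE, §5.2 (5.10), (5.14) p. 1092] -/
theorem norm_cosPowSinSqSinSqRow_μI_le (a : ℕ) (v y : ℝ) (m : ℤ) :
    ‖∫ t, (((Real.cos t) ^ a * Real.sin t ^ 2 * Real.sin t ^ 2 : ℝ) : ℂ)
        * Complex.exp (((v * Real.cos t : ℝ) : ℂ) + ((y * Real.cos (m * t) : ℝ) : ℂ) * Complex.I) ∂μI‖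
      ≤ π / 4 * (3 * besselI 0 v - 4 * besselI 2 v + besselI 4 v) := by
  have h := norm_weightRow_mul_μI_le (fun t => Real.cos t ^ a) (fun t => Real.sin t ^ 2 * Real.sin t ^ 2)
    (fun t => by rw [abs_pow]; exact pow_le_one₀ (abs_nonneg _) (abs_cos_le_one t))
    (fun t => by positivity) (by fun_prop) v y m
  rw [integral_sin_sq_mul_sin_sq_mul_exp_mul_cos_μI] at h
  have e : (fun t : ℝ => (((Real.cos t) ^ a * Real.sin t ^ 2 * Real.sin t ^ 2 : ℝ) : ℂ)
        * Complex.exp (((v * Real.cos t : ℝ) : ℂ) + ((y * Real.cos (m * t) : ℝ) : ℂ) * Complex.I))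
      = fun t => (((Real.cos t) ^ a * (Real.sin t ^ 2 * Real.sin t ^ 2) : ℝ) : ℂ)
        * Complex.exp (((v * Real.cos t : ℝ) : ℂ) + ((y * Real.cos (m * t) : ℝ) : ℂ) * Complex.I) := by
    funext t
    rw [mul_assoc (Real.cos t ^ a)]
  rw [e]
  exact h

/-- Two-kept anchor product, distinct coordinates: `X² · Y^{d−2}`. [folklore] -/
private theorem prod_keptAnchor₂_eq {j0 j1 : Fin d} (hj : j0 ≠ j1) (X Y : ℝ) :
    ∏ μ : Fin d, (if μ = j0 ∨ μ = j1 then X else Y) = X ^ 2 * Y ^ (d - 2) := by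
  have hj1 : j1 ∈ Finset.univ.erase j0 := Finset.mem_erase.2 ⟨hj.symm, Finset.mem_univ _⟩
  rw [← Finset.mul_prod_erase Finset.univ _ (Finset.mem_univ j0),
    ← Finset.mul_prod_erase _ _ hj1, if_pos (Or.inl rfl), if_pos (Or.inr rfl)]
  rw [Finset.prod_congr rfl (fun μ hμ => if_neg (by
      obtain ⟨h1, hμ'⟩ := Finset.mem_erase.1 hμ
      obtain ⟨h0, -⟩ := Finset.mem_erase.1 hμ'
      exact not_or.mpr ⟨h0, h1⟩)), Finset.prod_const,
    Finset.card_erase_of_mem hj1, Finset.card_erase_of_mem (Finset.mem_univ j0), Finset.card_univ,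
    Fintype.card_fin, show d - 1 - 1 = d - 2 by omega]
  ring

/-- **Integrability of the two-kept anchor product in the sharp range.** For `d ≥ 2n+3` and any `j₀, j₁`,
`τ ↦ τ^{n+2} e^{−τ} Π_μ A_μ(τ/d)` is integrable on `(0,∞)`, where `A_{j₀} = A_{j₁} = π(I_0 − I_2)` if
`j₀ ≠ j₁`, `A_{j₀} = (π/4)(3I_0 − 4I_2 + I_4)` if `j₀ = j₁`, and `A_μ = 2π I_0` otherwise: both kept anchors
decay one order faster each (`(I_0−I_2)(v) ≤ 2I_0/v`, `(π/4)(3I_0−4I_2+I_4)(v) ≤ 6πI_0/v²`), so the integrand is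
dominated by `3d² (2π)^d · τⁿ q_{τ/d}(0)^d`.
[cite: FitznerVanDerHofstad2016NoBLE, §5.1.1 (5.2)–(5.4), §5.2 (5.10), (5.14) p. 1092; DLMF, 10.29.1] -/
theorem integrableOn_pow_succ_succ_mul_exp_neg_mul_prod_keptAnchor₂ (n : ℕ) (hd : 2 * n + 3 ≤ d)
    (j0 j1 : Fin d) :
    IntegrableOn (fun τ : ℝ => τ ^ (n + 2) * (Real.exp (-τ) * ∏ μ : Fin d,
      (if μ = j0 then
        (if μ = j1 then π / 4 * (3 * besselI 0 (τ / d) - 4 * besselI 2 (τ / d) + besselI 4 (τ / d))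
          else π * (besselI 0 (τ / d) - besselI 2 (τ / d)))
       else
        (if μ = j1 then π * (besselI 0 (τ / d) - besselI 2 (τ / d))
          else 2 * π * besselI 0 (τ / d))))) (Ioi 0) := by
  have hd1 : 1 ≤ d := by omega
  have hd2 : 2 ≤ d := by omega
  have hd0 : (0 : ℝ) < d := by exact_mod_cast (by omega : 0 < d)
  have hdne : (d : ℝ) ≠ 0 := hd0.ne'
  have hq : ∀ τ : ℝ, Real.exp (-τ) * besselI 0 (τ / d) ^ d = srwHeatKernel (τ / d) 0 ^ d := by
    intro τ
    rw [srwHeatKernel_eq_exp_neg_mul_besselI, mul_pow, ← Real.exp_nat_mul]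
    congr 2
    field_simp
  have hmaj : IntegrableOn (fun τ : ℝ => 3 * (d : ℝ) ^ 2 * (2 * π) ^ d
      * (τ ^ n * srwHeatKernel (τ / d) 0 ^ d)) (Ioi 0) :=
    (integrableOn_pow_mul_srwHeatKernel_zero_pow n hd).const_mul _
  by_cases hj : j0 = j1
  · -- the `sin⁴` anchor at `j0`, plain rows elsewhere
    subst hj
    have e : ∀ τ : ℝ, (∏ μ : Fin d, (if μ = j0 then
          (if μ = j0 then π / 4 * (3 * besselI 0 (τ / d) - 4 * besselI 2 (τ / d) + besselI 4 (τ / d))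
            else π * (besselI 0 (τ / d) - besselI 2 (τ / d)))
         else (if μ = j0 then π * (besselI 0 (τ / d) - besselI 2 (τ / d)) else 2 * π * besselI 0 (τ / d))))
        = π / 4 * (3 * besselI 0 (τ / d) - 4 * besselI 2 (τ / d) + besselI 4 (τ / d))
          * (2 * π * besselI 0 (τ / d)) ^ (d - 1) := by
      intro τ
      rw [← Finset.mul_prod_erase Finset.univ _ (Finset.mem_univ j0), if_pos rfl, if_pos rfl]
      congr 1
      rw [Finset.prod_congr rfl (fun μ hμ => by
          rw [if_neg (Finset.ne_of_mem_erase hμ), if_neg (Finset.ne_of_mem_erase hμ)]),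
        Finset.prod_const, Finset.card_erase_of_mem (Finset.mem_univ j0), Finset.card_univ,
        Fintype.card_fin]
    simp_rw [e]
    have hcont : Continuous (fun τ : ℝ => τ ^ (n + 2) * (Real.exp (-τ)
        * (π / 4 * (3 * besselI 0 (τ / d) - 4 * besselI 2 (τ / d) + besselI 4 (τ / d))
          * (2 * π * besselI 0 (τ / d)) ^ (d - 1)))) :=
      (continuous_pow (n + 2)).mul ((Real.continuous_exp.comp continuous_neg).mul
        ((continuous_const.mul (((continuous_const.mul (continuous_besselI_div 0)).sub
          (continuous_const.mul (continuous_besselI_div 2))).add (continuous_besselI_div 4))).mul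
          ((continuous_const.mul (continuous_besselI_div 0)).pow _)))
    refine hmaj.mono' hcont.aestronglyMeasurable ?_
    rw [ae_restrict_iff' measurableSet_Ioi]
    refine Eventually.of_forall fun τ (hτ : (0:ℝ) < τ) => ?_
    have hv : 0 < τ / d := by positivity
    have hI0 : 0 ≤ besselI 0 (τ / d) := besselI_nonneg hv.le 0
    have hK0 := sinFour_anchor_nonneg (τ / d)
    have hK : π / 4 * (3 * besselI 0 (τ / d) - 4 * besselI 2 (τ / d) + besselI 4 (τ / d))
        ≤ 2 * π * besselI 0 (τ / d) * (3 * ((d : ℝ) / τ) ^ 2) := by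
      have h := sinFour_anchor_le hv
      have e3 : 3 / (τ / d) ^ 2 = 3 * ((d : ℝ) / τ) ^ 2 := by
        field_simp
      rw [e3] at h
      exact h
    rw [Real.norm_eq_abs, abs_of_nonneg (by positivity)]
    have e' : (2 * π * besselI 0 (τ / d)) * (2 * π * besselI 0 (τ / d)) ^ (d - 1)
        = (2 * π) ^ d * besselI 0 (τ / d) ^ d := by
      rw [← pow_succ', Nat.sub_add_cancel hd1, mul_pow]
    have e'' : τ ^ 2 * (((d : ℝ) / τ) ^ 2) = (d : ℝ) ^ 2 := by field_simp
    calc τ ^ (n + 2) * (Real.exp (-τ) * (π / 4 * (3 * besselI 0 (τ / d) - 4 * besselI 2 (τ / d)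
          + besselI 4 (τ / d)) * (2 * π * besselI 0 (τ / d)) ^ (d - 1)))
        ≤ τ ^ (n + 2) * (Real.exp (-τ) * (2 * π * besselI 0 (τ / d) * (3 * ((d : ℝ) / τ) ^ 2)
          * (2 * π * besselI 0 (τ / d)) ^ (d - 1))) := by gcongr
      _ = 3 * (τ ^ 2 * (((d : ℝ) / τ) ^ 2)) * (τ ^ n * (Real.exp (-τ)
          * ((2 * π * besselI 0 (τ / d)) * (2 * π * besselI 0 (τ / d)) ^ (d - 1)))) := by ring
      _ = 3 * (d : ℝ) ^ 2 * (2 * π) ^ d * (τ ^ n * (Real.exp (-τ) * besselI 0 (τ / d) ^ d)) := by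
          rw [e', e'']; ring
      _ = 3 * (d : ℝ) ^ 2 * (2 * π) ^ d * (τ ^ n * srwHeatKernel (τ / d) 0 ^ d) := by rw [hq]
  · -- two `sin²` anchors at `j0 ≠ j1`, plain rows elsewhere
    have e : ∀ τ : ℝ, (∏ μ : Fin d, (if μ = j0 then
          (if μ = j1 then π / 4 * (3 * besselI 0 (τ / d) - 4 * besselI 2 (τ / d) + besselI 4 (τ / d))
            else π * (besselI 0 (τ / d) - besselI 2 (τ / d)))
         else (if μ = j1 then π * (besselI 0 (τ / d) - besselI 2 (τ / d)) else 2 * π * besselI 0 (τ / d))))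
        = (π * (besselI 0 (τ / d) - besselI 2 (τ / d))) ^ 2 * (2 * π * besselI 0 (τ / d)) ^ (d - 2) := by
      intro τ
      rw [← prod_keptAnchor₂_eq hj]
      refine Finset.prod_congr rfl fun μ _ => ?_
      by_cases h0 : μ = j0
      · subst h0
        simp [hj]
      · by_cases h1 : μ = j1
        · subst h1
          simp [h0]
        · simp [h0, h1]
    simp_rw [e]
    have hcont : Continuous (fun τ : ℝ => τ ^ (n + 2) * (Real.exp (-τ)
        * ((π * (besselI 0 (τ / d) - besselI 2 (τ / d))) ^ 2 * (2 * π * besselI 0 (τ / d)) ^ (d - 2)))) :=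
      (continuous_pow (n + 2)).mul ((Real.continuous_exp.comp continuous_neg).mul
        (((continuous_const.mul ((continuous_besselI_div 0).sub (continuous_besselI_div 2))).pow 2).mul
          ((continuous_const.mul (continuous_besselI_div 0)).pow _)))
    refine hmaj.mono' hcont.aestronglyMeasurable ?_
    rw [ae_restrict_iff' measurableSet_Ioi]
    refine Eventually.of_forall fun τ (hτ : (0:ℝ) < τ) => ?_
    have hv : 0 < τ / d := by positivity
    have hI0 : 0 ≤ besselI 0 (τ / d) := besselI_nonneg hv.le 0
    have hK0 : 0 ≤ π * (besselI 0 (τ / d) - besselI 2 (τ / d)) :=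
      mul_nonneg Real.pi_pos.le (besselI_zero_sub_two_nonneg hv.le)
    have hK : π * (besselI 0 (τ / d) - besselI 2 (τ / d)) ≤ 2 * π * besselI 0 (τ / d) * (d / τ) := by
      have h := besselI_zero_sub_two_le_div hv
      have : 2 * besselI 0 (τ / d) / (τ / d) = 2 * besselI 0 (τ / d) * (d / τ) := by
        field_simp
      nlinarith [Real.pi_pos, h, this]
    rw [Real.norm_eq_abs, abs_of_nonneg (by positivity)]
    have e' : (2 * π * besselI 0 (τ / d)) ^ 2 * (2 * π * besselI 0 (τ / d)) ^ (d - 2)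
        = (2 * π) ^ d * besselI 0 (τ / d) ^ d := by
      rw [← pow_add, show 2 + (d - 2) = d by omega, mul_pow]
    have e'' : τ ^ 2 * (((d : ℝ) / τ) ^ 2) = (d : ℝ) ^ 2 := by field_simp
    calc τ ^ (n + 2) * (Real.exp (-τ) * ((π * (besselI 0 (τ / d) - besselI 2 (τ / d))) ^ 2
          * (2 * π * besselI 0 (τ / d)) ^ (d - 2)))
        ≤ τ ^ (n + 2) * (Real.exp (-τ) * ((2 * π * besselI 0 (τ / d) * (d / τ)) ^ 2
          * (2 * π * besselI 0 (τ / d)) ^ (d - 2))) := by gcongr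
      _ = (τ ^ 2 * (((d : ℝ) / τ) ^ 2)) * (τ ^ n * (Real.exp (-τ)
          * ((2 * π * besselI 0 (τ / d)) ^ 2 * (2 * π * besselI 0 (τ / d)) ^ (d - 2)))) := by ring
      _ = (d : ℝ) ^ 2 * (2 * π) ^ d * (τ ^ n * (Real.exp (-τ) * besselI 0 (τ / d) ^ d)) := by
          rw [e', e'']; ring
      _ ≤ 3 * (d : ℝ) ^ 2 * (2 * π) ^ d * (τ ^ n * (Real.exp (-τ) * besselI 0 (τ / d) ^ d)) := by
          have h0 : 0 ≤ (d : ℝ) ^ 2 * (2 * π) ^ d * (τ ^ n * (Real.exp (-τ) * besselI 0 (τ / d) ^ d)) := by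
            positivity
          nlinarith [h0]
      _ = 3 * (d : ℝ) ^ 2 * (2 * π) ^ d * (τ ^ n * srwHeatKernel (τ / d) 0 ^ d) := by rw [hq]

/-- **The two-kept seed as a Schwinger integral of the anchor product**: for `d ≥ 2n+1` and any `j₀, j₁`,
`Tw_{n+2}[sin²(k_{j₀}) sin²(k_{j₁})](0; 0) = ((n+1)!)⁻¹ ∫₀^∞ τ^{n+1} e^{−τ} Π_μ A_μ(τ/d) dτ/(2π)^d` with the
two-kept anchors (`sin⁴` anchor when `j₀ = j₁`).
[cite: FitznerVanDerHofstad2016NoBLE, §5.1.1 (5.2)–(5.4), §5.2 (5.10), (5.14) p. 1092; DLMF, 10.32.1, 10.32.3] -/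
theorem srwTwist_sinSq_sinSq_zero_eq_integral_keptAnchor₂ (n : ℕ) (hd : 2 * n + 1 ≤ d) (j0 j1 : Fin d) :
    srwTwist d (n + 2) (fun k => Real.sin (k j0) ^ 2 * Real.sin (k j1) ^ 2) 0 0
      = ((n + 1) ! : ℝ)⁻¹ * (∫ τ in Ioi (0:ℝ), τ ^ (n + 1) * (Real.exp (-τ) * ∏ μ : Fin d,
          (if μ = j0 then
            (if μ = j1 then π / 4 * (3 * besselI 0 (τ / d) - 4 * besselI 2 (τ / d) + besselI 4 (τ / d))
              else π * (besselI 0 (τ / d) - besselI 2 (τ / d)))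
           else
            (if μ = j1 then π * (besselI 0 (τ / d) - besselI 2 (τ / d))
              else 2 * π * besselI 0 (τ / d))))) / (2 * π) ^ d := by
  set g : Fin d → ℝ → ℝ := fun μ t =>
    (if μ = j0 then Real.sin t ^ 2 else 1) * (if μ = j1 then Real.sin t ^ 2 else 1) with hg
  have hgc : ∀ μ, Continuous (g μ) := fun μ => by
    simp only [hg]; split_ifs <;> fun_prop
  have hs1 : ∀ t : ℝ, Real.sin t ^ 2 ≤ 1 := fun t => by
    rw [Real.sin_sq]; nlinarith [sq_nonneg (Real.cos t)]
  have hg1 : ∀ μ t, |g μ t| ≤ 1 := fun μ t => by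
    simp only [hg]
    rw [abs_mul]
    refine mul_le_one₀ ?_ (abs_nonneg _) ?_
    · split_ifs
      · rw [abs_of_nonneg (sq_nonneg _)]; exact hs1 t
      · simp
    · split_ifs
      · rw [abs_of_nonneg (sq_nonneg _)]; exact hs1 t
      · simp
  have hw : (fun k : Fin d → ℝ => Real.sin (k j0) ^ 2 * Real.sin (k j1) ^ 2) = fun k => ∏ μ, g μ (k μ) := by
    funext k
    simp only [hg]
    rw [Finset.prod_mul_distrib, Finset.prod_ite_eq', Finset.prod_ite_eq']
    simp
  have hint : Integrable (fun k => ((∏ μ, g μ (k μ)) * Real.cos (0 * DhatSym d (Pi.single j0 (0:ℤ)) k))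
      * Chat d 1 k ^ (n + 1 + 1)) (P d) := by
    refine (integrable_weight_sin_sq_sin_sq_cos_mul_Chat_pow_succ_succ hd (w := fun _ => (1:ℝ))
      measurable_const (W := 1) (fun k => by simp) j0 j1 (Pi.single j0 (0:ℤ)) 0).congr
      (ae_of_all _ fun k => ?_)
    simp only [one_mul]
    rw [congrFun hw k]
  have h := srwTwist_succ_prod_single_eq_integral_of_integrable (n + 1) j0 0 0 g hgc hg1 hint
  rw [← hw, Pi.single_zero] at h
  rw [h]
  congr 2
  refine setIntegral_congr_fun measurableSet_Ioi fun τ _ => ?_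
  congr 2
  have hrow : ∀ μ, (∫ t, (g μ t : ℂ) * Complex.exp (((τ / d * Real.cos t : ℝ) : ℂ)
      + (((0:ℝ) / d * Real.cos ((0:ℤ) * t) : ℝ) : ℂ) * Complex.I) ∂μI)
      = ((if μ = j0 then
            (if μ = j1 then π / 4 * (3 * besselI 0 (τ / d) - 4 * besselI 2 (τ / d) + besselI 4 (τ / d))
              else π * (besselI 0 (τ / d) - besselI 2 (τ / d)))
           else
            (if μ = j1 then π * (besselI 0 (τ / d) - besselI 2 (τ / d))
              else 2 * π * besselI 0 (τ / d)) : ℝ) : ℂ) := by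
    intro μ
    have e1 : (fun t : ℝ => (g μ t : ℂ) * Complex.exp (((τ / d * Real.cos t : ℝ) : ℂ)
        + (((0:ℝ) / d * Real.cos ((0:ℤ) * t) : ℝ) : ℂ) * Complex.I))
        = fun t => (((g μ t * Real.exp (τ / d * Real.cos t)) : ℝ) : ℂ) := by
      funext t
      simp only [zero_div, zero_mul, Complex.ofReal_zero, add_zero]
      push_cast
      ring
    rw [e1, integral_complex_ofReal]
    congr 1
    simp only [hg]
    by_cases h0 : μ = j0
    · by_cases h1 : μ = j1
      · subst h0; subst h1
        simp only [if_true]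
        exact integral_sin_sq_mul_sin_sq_mul_exp_mul_cos_μI (τ / d)
      · subst h0
        simp only [if_true, h1, if_false, mul_one]
        exact integral_sin_sq_mul_exp_mul_cos_μI (τ / d)
    · by_cases h1 : μ = j1
      · subst h1
        simp only [h0, if_false, if_true, one_mul]
        exact integral_sin_sq_mul_exp_mul_cos_μI (τ / d)
      · simp only [h0, h1, if_false, one_mul]
        exact integral_exp_mul_cos_μI (τ / d)
  simp_rw [hrow]
  rw [← Complex.ofReal_prod, Complex.ofReal_re]

/-- **Truncation + literal-substitution budget of a TWO-KEPT slice, one-seed form.** For `d ≥ 2n+3`,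
`m ≠ 0`, exponents `a`, kept `sin²` at `j₀` and at `j₁` (a `sin⁴` when `j₀ = j₁`), order `J`, any table `c′`:
`|Tw_{n+3}[Π_μ cos^{a_μ}(k_μ) sin²(k_{j₀}) sin²(k_{j₁})](m e_i; β) − ((n+2)!)⁻¹ ∫₀^∞ τ^{n+2} e^{−τ} Re Π_μ P_μ(c′)(τ) dτ/(2π)^d|`
`≤ [((1 + 2δ_J(β/d))^d − 1) + (Π_μ(α′_μ+η_μ) − Π_μ α′_μ)/(2π)^d] · Tw_{n+3}[sin²(k_{j₀}) sin²(k_{j₁})](0; 0)`,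
with row weights `W^{(a)} − 2W^{(a+2)} + W^{(a+4)}` at `μ = j₀ = j₁`, `W^{(a)} − W^{(a+2)}` at exactly one of
`j₀, j₁`, `W^{(a_μ)}` elsewhere; `c`, `δ_J`, `α′`, `η` as in the one-kept budget.
[cite: FitznerVanDerHofstad2016NoBLE, (3.34)–(3.38) p. 1071, §5.1.1 (5.2)–(5.5), §5.2 (5.9)–(5.10), (5.14) p. 1092; DLMF, 10.35.2, 10.14.4, 10.29.1] -/
theorem abs_srwTwist_prodCosPowSinSqSinSq_sub_prodRowObj_le (n : ℕ) (hd : 2 * n + 3 ≤ d)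
    (i j0 j1 : Fin d) {m : ℤ} (hm : m ≠ 0) (β : ℝ) (a : Fin d → ℕ) (J : ℕ) (c' : Fin d → ℕ → ℂ) :
    |srwTwist d (n + 3) (fun k => ∏ μ, Real.cos (k μ) ^ a μ
        * (if μ = j0 then Real.sin (k μ) ^ 2 else 1) * (if μ = j1 then Real.sin (k μ) ^ 2 else 1))
        (Pi.single i m) β
      - ((n + 2) ! : ℝ)⁻¹ * (∫ τ in Ioi (0:ℝ), τ ^ (n + 2) * (Real.exp (-τ) *
        (∏ μ, ∑ j ∈ Finset.range (J + 1), (if j = 0 then (1 : ℂ) else 2)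
          * ((if μ = j0 then
              (if μ = j1 then
                ((∑ s ∈ Finset.range (a μ + 1), (((a μ).choose s : ℂ) / 2 ^ (a μ))
                    * (besselI (j * m - ((2 * (s : ℤ) - (a μ : ℕ) : ℤ))) (τ / d) : ℂ))
                  - 2 * (∑ s ∈ Finset.range (a μ + 2 + 1), (((a μ + 2).choose s : ℂ) / 2 ^ (a μ + 2))
                    * (besselI (j * m - ((2 * (s : ℤ) - (a μ + 2 : ℕ) : ℤ))) (τ / d) : ℂ))
                  + ∑ s ∈ Finset.range (a μ + 4 + 1), (((a μ + 4).choose s : ℂ) / 2 ^ (a μ + 4))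
                    * (besselI (j * m - ((2 * (s : ℤ) - (a μ + 4 : ℕ) : ℤ))) (τ / d) : ℂ))
               else
                ((∑ s ∈ Finset.range (a μ + 1), (((a μ).choose s : ℂ) / 2 ^ (a μ))
                    * (besselI (j * m - ((2 * (s : ℤ) - (a μ : ℕ) : ℤ))) (τ / d) : ℂ))
                  - ∑ s ∈ Finset.range (a μ + 2 + 1), (((a μ + 2).choose s : ℂ) / 2 ^ (a μ + 2))
                    * (besselI (j * m - ((2 * (s : ℤ) - (a μ + 2 : ℕ) : ℤ))) (τ / d) : ℂ)))
             else
              (if μ = j1 then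
                ((∑ s ∈ Finset.range (a μ + 1), (((a μ).choose s : ℂ) / 2 ^ (a μ))
                    * (besselI (j * m - ((2 * (s : ℤ) - (a μ : ℕ) : ℤ))) (τ / d) : ℂ))
                  - ∑ s ∈ Finset.range (a μ + 2 + 1), (((a μ + 2).choose s : ℂ) / 2 ^ (a μ + 2))
                    * (besselI (j * m - ((2 * (s : ℤ) - (a μ + 2 : ℕ) : ℤ))) (τ / d) : ℂ))
               else
                ∑ s ∈ Finset.range (a μ + 1), (((a μ).choose s : ℂ) / 2 ^ (a μ))
                    * (besselI (j * m - ((2 * (s : ℤ) - (a μ : ℕ) : ℤ))) (τ / d) : ℂ)))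
            * c' μ j)).re)) / (2 * π) ^ d|
    ≤ (((1 + 2 * ∑' l : ℕ, |besselJ (l + J + 1) (β / d)|) ^ d - 1)
        + ((∏ μ, ((∑ j ∈ Finset.range (J + 1), (if j = 0 then (1 : ℝ) else 2) * ‖c' μ j‖)
            + ∑ j ∈ Finset.range (J + 1), (if j = 0 then (1 : ℝ) else 2)
              * ‖2 * π * Complex.I ^ j * (besselJ j (β / d) : ℂ) - c' μ j‖))
          - ∏ μ, ∑ j ∈ Finset.range (J + 1), (if j = 0 then (1 : ℝ) else 2) * ‖c' μ j‖) / (2 * π) ^ d)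
      * srwTwist d (n + 3) (fun k => Real.sin (k j0) ^ 2 * Real.sin (k j1) ^ 2) 0 0 := by
  have hd' : 2 * (n + 1) + 1 ≤ d := by omega
  have hd0 : (0 : ℝ) < d := by exact_mod_cast (by omega : 0 < d)
  have hπ0 : (0 : ℝ) < 2 * π := by positivity
  -- the objects of the abstract budget
  set g : Fin d → ℝ → ℝ := fun μ t => Real.cos t ^ a μ
    * (if μ = j0 then Real.sin t ^ 2 else 1) * (if μ = j1 then Real.sin t ^ 2 else 1) with hg
  set T : Fin d → ℝ → ℂ := fun μ τ => ∫ t, (g μ t : ℂ) * Complex.exp (((τ / d * Real.cos t : ℝ) : ℂ)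
      + ((β / d * Real.cos (m * t) : ℝ) : ℂ) * Complex.I) ∂μI with hT
  set Wa : ℕ → ℕ → ℝ → ℂ := fun b j τ => ∑ s ∈ Finset.range (b + 1), ((b.choose s : ℂ) / 2 ^ b)
      * (besselI (j * m - ((2 * (s : ℤ) - (b : ℕ) : ℤ))) (τ / d) : ℂ) with hWa
  set W : Fin d → ℕ → ℝ → ℂ := fun μ j τ =>
    if μ = j0 then
      (if μ = j1 then Wa (a μ) j τ - 2 * Wa (a μ + 2) j τ + Wa (a μ + 4) j τ
        else Wa (a μ) j τ - Wa (a μ + 2) j τ)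
    else (if μ = j1 then Wa (a μ) j τ - Wa (a μ + 2) j τ else Wa (a μ) j τ) with hW
  set A : Fin d → ℝ → ℝ := fun μ τ =>
    if μ = j0 then
      (if μ = j1 then π / 4 * (3 * besselI 0 (τ / d) - 4 * besselI 2 (τ / d) + besselI 4 (τ / d))
        else π * (besselI 0 (τ / d) - besselI 2 (τ / d)))
    else (if μ = j1 then π * (besselI 0 (τ / d) - besselI 2 (τ / d)) else 2 * π * besselI 0 (τ / d))
    with hA
  set c : Fin d → ℕ → ℂ := fun _ j => 2 * π * Complex.I ^ j * (besselJ j (β / d) : ℂ) with hc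
  set δ : ℝ := ∑' l : ℕ, |besselJ (l + J + 1) (β / d)| with hδ
  have hδ0 : 0 ≤ δ := tsum_nonneg fun l => abs_nonneg _
  have hs1 : ∀ t : ℝ, Real.sin t ^ 2 ≤ 1 := fun t => by
    rw [Real.sin_sq]; nlinarith [sq_nonneg (Real.cos t)]
  -- continuity and boundedness of the weights
  have hgc : ∀ μ, Continuous (g μ) := fun μ => by
    simp only [hg]; split_ifs <;> fun_prop
  have hg1 : ∀ μ t, |g μ t| ≤ 1 := fun μ t => by
    simp only [hg]
    rw [abs_mul, abs_mul, abs_pow]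
    refine mul_le_one₀ (mul_le_one₀ (pow_le_one₀ (abs_nonneg _) (abs_cos_le_one t)) (abs_nonneg _) ?_)
      (abs_nonneg _) ?_
    · split_ifs
      · rw [abs_of_nonneg (sq_nonneg _)]; exact hs1 t
      · simp
    · split_ifs
      · rw [abs_of_nonneg (sq_nonneg _)]; exact hs1 t
      · simp
  have hTc : ∀ μ, Continuous (T μ) := fun μ => continuous_weightRow (g μ) (hgc μ) (β / d) m
  have hWac : ∀ b j, Continuous (Wa b j) := fun b j => continuous_cosPowWeight b m j
  have hWc : ∀ μ j, Continuous (W μ j) := fun μ j => by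
    simp only [hW]; split_ifs
    · exact ((hWac _ _).sub (continuous_const.mul (hWac _ _))).add (hWac _ _)
    · exact (hWac _ _).sub (hWac _ _)
    · exact (hWac _ _).sub (hWac _ _)
    · exact hWac _ _
  have hA0 : ∀ μ (τ : ℝ), 0 < τ → 0 ≤ A μ τ := fun μ τ hτ => by
    have hv : 0 ≤ τ / d := by positivity
    simp only [hA]; split_ifs
    · exact sinFour_anchor_nonneg (τ / d)
    · exact mul_nonneg Real.pi_pos.le (besselI_zero_sub_two_nonneg hv)
    · exact mul_nonneg Real.pi_pos.le (besselI_zero_sub_two_nonneg hv)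
    · exact mul_nonneg hπ0.le (besselI_nonneg hv 0)
  have hAi : IntegrableOn (fun τ : ℝ => τ ^ (n + 2) * (Real.exp (-τ) * ∏ μ, A μ τ)) (Ioi 0) :=
    integrableOn_pow_succ_succ_mul_exp_neg_mul_prod_keptAnchor₂ n hd j0 j1
  -- the three row estimates, by the four cases `μ = j0 ?`, `μ = j1 ?`
  have hTA : ∀ μ (τ : ℝ), 0 < τ → ‖T μ τ‖ ≤ A μ τ := fun μ τ hτ => by
    simp only [hT, hA, hg]
    by_cases h0 : μ = j0
    · by_cases h1 : μ = j1
      · subst h0; subst h1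
        simp only [if_true]
        exact norm_cosPowSinSqSinSqRow_μI_le (a μ) (τ / d) (β / d) m
      · subst h0
        simp only [if_true, h1, if_false, mul_one]
        exact norm_cosPowSinSqRow_μI_le (a μ) (τ / d) (β / d) m
    · by_cases h1 : μ = j1
      · subst h1
        simp only [h0, if_false, if_true, mul_one]
        exact norm_cosPowSinSqRow_μI_le (a μ) (τ / d) (β / d) m
      · simp only [h0, h1, if_false, mul_one]
        exact norm_cosPowRow_μI_le (a μ) (τ / d) (β / d) m
  have hball : ∀ μ (τ : ℝ), 0 < τ → ‖T μ τ - ∑ j ∈ Finset.range (J + 1),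
      (if j = 0 then (1 : ℂ) else 2) * (W μ j τ * c μ j)‖ ≤ 2 * δ * A μ τ := fun μ τ hτ => by
    have hv : 0 ≤ τ / d := by positivity
    simp only [hT, hW, hA, hc, hg, hWa]
    by_cases h0 : μ = j0
    · by_cases h1 : μ = j1
      · subst h0; subst h1
        simp only [if_true]
        have h := norm_cosPowSinSqSinSqRow_sub_foldTrunc_le (τ / d) (β / d) hm (a μ) J
        calc _ ≤ π / 2 * (3 * besselI 0 (τ / d) - 4 * besselI 2 (τ / d) + besselI 4 (τ / d)) * δ := h
          _ = 2 * δ * (π / 4 * (3 * besselI 0 (τ / d) - 4 * besselI 2 (τ / d) + besselI 4 (τ / d))) := by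
              ring
      · subst h0
        simp only [if_true, h1, if_false, mul_one]
        have h := norm_cosPowSinSqRow_sub_foldTrunc_le (τ / d) (β / d) hm (a μ) J
        calc _ ≤ 2 * π * (besselI 0 (τ / d) - besselI 2 (τ / d)) * δ := h
          _ = 2 * δ * (π * (besselI 0 (τ / d) - besselI 2 (τ / d))) := by ring
    · by_cases h1 : μ = j1
      · subst h1
        simp only [h0, if_false, if_true, mul_one]
        have h := norm_cosPowSinSqRow_sub_foldTrunc_le (τ / d) (β / d) hm (a μ) J
        calc _ ≤ 2 * π * (besselI 0 (τ / d) - besselI 2 (τ / d)) * δ := h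
          _ = 2 * δ * (π * (besselI 0 (τ / d) - besselI 2 (τ / d))) := by ring
      · simp only [h0, h1, if_false, mul_one]
        have h := norm_sub_foldTrunc_le_of_hasSum_of_norm_le (β / d)
          (hasSum_cos_pow_besselRow_μI (a μ) (τ / d) (β / d) hm)
          (fun k => cosPowWeight_neg (a μ) (τ / d) m k)
          (fun j => norm_cosPowWeight_le_besselI_zero (a μ) hv m j) J
        calc _ ≤ 2 * (2 * π * besselI 0 (τ / d)) * δ := h
          _ = 2 * δ * (2 * π * besselI 0 (τ / d)) := by ring
  have hWA : ∀ μ j (τ : ℝ), 0 < τ → ‖W μ j τ‖ ≤ A μ τ / (2 * π) := fun μ j τ hτ => by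
    have hv : 0 ≤ τ / d := by positivity
    simp only [hW, hA, hWa]
    by_cases h0 : μ = j0
    · by_cases h1 : μ = j1
      · subst h0; subst h1
        simp only [if_true]
        have h := norm_cosPowWeight_sub_two_mul_add_le (a μ) (τ / d) m j
        calc _ ≤ (3 * besselI 0 (τ / d) - 4 * besselI 2 (τ / d) + besselI 4 (τ / d)) / 8 := h
          _ = π / 4 * (3 * besselI 0 (τ / d) - 4 * besselI 2 (τ / d) + besselI 4 (τ / d)) / (2 * π) := by
              field_simp
              ring
      · subst h0
        simp only [if_true, h1, if_false]
        have h := norm_cosPowWeight_sub_le (a μ) (τ / d) m j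
        calc _ ≤ (besselI 0 (τ / d) - besselI 2 (τ / d)) / 2 := h
          _ = π * (besselI 0 (τ / d) - besselI 2 (τ / d)) / (2 * π) := by field_simp
    · by_cases h1 : μ = j1
      · subst h1
        simp only [h0, if_false, if_true]
        have h := norm_cosPowWeight_sub_le (a μ) (τ / d) m j
        calc _ ≤ (besselI 0 (τ / d) - besselI 2 (τ / d)) / 2 := h
          _ = π * (besselI 0 (τ / d) - besselI 2 (τ / d)) / (2 * π) := by field_simp
      · simp only [h0, h1, if_false]
        have h := norm_cosPowWeight_le_besselI_zero (a μ) hv m j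
        calc _ ≤ besselI 0 (τ / d) := h
          _ = 2 * π * besselI 0 (τ / d) / (2 * π) := by field_simp
  -- the abstract budget
  have hB := abs_rowObj_sub_prodTruncObj_le (n + 2) T W A hTc hWc hA0 hAi J c c' hδ0 hTA hball hWA
  -- the true object is the slice; the anchor object is the two-kept seed
  have hint : Integrable (fun k => ((∏ μ, g μ (k μ)) * Real.cos (β * DhatSym d (Pi.single i m) k))
      * Chat d 1 k ^ (n + 2 + 1)) (P d) :=
    integrable_prodCosPow_sin_sq_sin_sq_cos_mul_Chat_pow_succ_succ hd' a j0 j1 (Pi.single i m) β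
  have e1 := srwTwist_succ_prod_single_eq_integral_of_integrable (n + 2) i m β g hgc hg1 hint
  have e2 : srwTwist d (n + 2 + 1) (fun k => Real.sin (k j0) ^ 2 * Real.sin (k j1) ^ 2) 0 0
      = ((n + 2) ! : ℝ)⁻¹ * (∫ τ in Ioi (0:ℝ), τ ^ (n + 2) * (Real.exp (-τ) * ∏ μ, A μ τ)) / (2 * π) ^ d :=
    srwTwist_sinSq_sinSq_zero_eq_integral_keptAnchor₂ (n + 1) hd' j0 j1
  rw [show n + 3 = n + 2 + 1 from rfl, e1, e2]
  exact hB


/-! ### Kept seeds are shifted plain seeds -/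

/-- `π(I_0 − I_2)(τ/d) = 2π I_1(τ/d) · (d/τ)` for `τ > 0` (the recurrence at order `0`). [cite: DLMF, 10.29.1] -/
private theorem keptAnchor_eq_mul_div {τ : ℝ} (hτ : 0 < τ) (hd0 : (0 : ℝ) < d) :
    π * (besselI 0 (τ / d) - besselI 2 (τ / d)) = 2 * π * besselI 1 (τ / d) * (d / τ) := by
  have hv : 0 < τ / d := by positivity
  have h := besselI_recurrence 0 (τ / d)
  push_cast at h
  simp only [zero_add] at h
  norm_num at h
  have e : besselI 0 (τ / d) - besselI 2 (τ / d) = 2 * besselI 1 (τ / d) / (τ / d) := by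
    rw [eq_div_iff hv.ne']
    linear_combination h
  rw [e, div_div_eq_mul_div]
  ring

/-- `(π/4)(3I_0 − 4I_2 + I_4)(τ/d) = 2π I_2(τ/d) · 3(d/τ)²` for `τ > 0`. [cite: DLMF, 10.29.1] -/
private theorem sinFourAnchor_eq_mul_div_sq {τ : ℝ} (hτ : 0 < τ) (hd0 : (0 : ℝ) < d) :
    π / 4 * (3 * besselI 0 (τ / d) - 4 * besselI 2 (τ / d) + besselI 4 (τ / d))
      = 2 * π * besselI 2 (τ / d) * (3 * ((d : ℝ) / τ) ^ 2) := by
  have hv : 0 < τ / d := by positivity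
  rw [three_besselI_zero_sub_add_eq_div_sq hv.ne']
  have hτ0 : τ ≠ 0 := hτ.ne'
  have hdne : (d : ℝ) ≠ 0 := hd0.ne'
  field_simp
  ring

/-- `e^{−τ} = (e^{−τ/d})^d` split as `e^{−τ/d} · (e^{−τ/d})^{d−1}`. [folklore] -/
private theorem exp_neg_eq_mul_pow {τ : ℝ} (hd1 : 1 ≤ d) :
    Real.exp (-τ) = Real.exp (-(τ / d)) * Real.exp (-(τ / d)) ^ (d - 1) := by
  have hd0 : (0 : ℝ) < d := by exact_mod_cast (by omega : 0 < d)
  rw [← pow_succ', Nat.sub_add_cancel hd1, ← Real.exp_nat_mul]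
  congr 1
  field_simp

/-- **The one-kept seed is a shifted plain seed**: for `d ≥ 2n+3`,
`Tw_{n+2}[sin²(k_{j₀})](0; 0) = (d/(n+1)) · I_{n+1,0}(e_{j₀})` — the kept anchor `π(I_0 − I_2)(τ/d) = 2πI_1(τ/d)·d/τ`
trades the extra `τ` for the Bessel index `1` at `j₀` (`srwI_succ_zero_eq_integral_prod_srwHeatKernel_div`).  So the kept
budgets are paid in the programme's existing currency `I_{n,0}(x)`.
[cite: FitznerVanDerHofstad2016NoBLE, (3.35) p. 1071, §5.1.1 (5.2)–(5.4); DLMF, 10.29.1] -/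
theorem srwTwist_sinSq_zero_eq_srwI (n : ℕ) (hd : 2 * n + 3 ≤ d) (j0 : Fin d) :
    srwTwist d (n + 2) (fun k => Real.sin (k j0) ^ 2) 0 0
      = (d : ℝ) / (n + 1) * srwI d (n + 1) 0 (Pi.single j0 1) := by
  have hd' : 2 * (n + 1) + 1 ≤ d := by omega
  have hd1 : 1 ≤ d := by omega
  have hd0 : (0 : ℝ) < d := by exact_mod_cast (by omega : 0 < d)
  have hπ0 : (0 : ℝ) < 2 * π := by positivity
  rw [srwTwist_sinSq_zero_eq_integral_keptAnchor (n + 1) hd' j0,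
    srwI_succ_zero_eq_integral_prod_srwHeatKernel_div n hd (Pi.single j0 1)]
  have hpt : ∀ τ : ℝ, τ ∈ Ioi (0:ℝ) → τ ^ (n + 1) * (Real.exp (-τ) * ∏ μ : Fin d,
      (if μ = j0 then π * (besselI 0 (τ / d) - besselI 2 (τ / d)) else 2 * π * besselI 0 (τ / d)))
      = (2 * π) ^ d * d * (τ ^ n * ∏ μ : Fin d, srwHeatKernel (τ / d) ((Pi.single j0 (1:ℤ) : Fin d → ℤ) μ)) := by
    intro τ hτ
    have hτ' : (0:ℝ) < τ := hτ
    rw [prod_keptAnchor_eq j0]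
    have hq : ∏ μ : Fin d, srwHeatKernel (τ / d) ((Pi.single j0 (1:ℤ) : Fin d → ℤ) μ)
        = srwHeatKernel (τ / d) 1 * srwHeatKernel (τ / d) 0 ^ (d - 1) := by
      rw [← Finset.mul_prod_erase Finset.univ _ (Finset.mem_univ j0), Pi.single_eq_same]
      congr 1
      rw [Finset.prod_congr rfl (fun μ hμ => by rw [Pi.single_eq_of_ne (Finset.ne_of_mem_erase hμ)]),
        Finset.prod_const, Finset.card_erase_of_mem (Finset.mem_univ j0), Finset.card_univ,
        Fintype.card_fin]
    rw [hq, keptAnchor_eq_mul_div hτ' hd0, srwHeatKernel_eq_exp_neg_mul_besselI (τ / d) 1,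
      srwHeatKernel_eq_exp_neg_mul_besselI (τ / d) 0, exp_neg_eq_mul_pow hd1 (τ := τ),
      mul_pow (2 * π) (besselI 0 (τ / d)) (d - 1), mul_pow (Real.exp (-(τ / d))) (besselI 0 (τ / d)) (d - 1),
      show (2 * π) ^ d = 2 * π * (2 * π) ^ (d - 1) by rw [← pow_succ', Nat.sub_add_cancel hd1]]
    have e5 : τ ^ (n + 1) * ((d : ℝ) / τ) = d * τ ^ n := by
      have hτ0 : τ ≠ 0 := hτ'.ne'
      field_simp
      ring
    calc τ ^ (n + 1) * (Real.exp (-(τ / d)) * Real.exp (-(τ / d)) ^ (d - 1)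
          * (2 * π * besselI 1 (τ / d) * (d / τ) * ((2 * π) ^ (d - 1) * besselI 0 (τ / d) ^ (d - 1))))
        = (τ ^ (n + 1) * ((d : ℝ) / τ)) * (2 * π * (2 * π) ^ (d - 1))
          * ((Real.exp (-(τ / d)) * besselI 1 (τ / d))
            * (Real.exp (-(τ / d)) ^ (d - 1) * besselI 0 (τ / d) ^ (d - 1))) := by ring
      _ = 2 * π * (2 * π) ^ (d - 1) * d * (τ ^ n * ((Real.exp (-(τ / d)) * besselI 1 (τ / d))
            * (Real.exp (-(τ / d)) ^ (d - 1) * besselI 0 (τ / d) ^ (d - 1)))) := by rw [e5]; ring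
  rw [setIntegral_congr_fun measurableSet_Ioi hpt, integral_const_mul]
  rw [Nat.factorial_succ]
  push_cast
  have hn0 : (n ! : ℝ) ≠ 0 := by positivity
  have hn1 : ((n : ℝ) + 1) ≠ 0 := by positivity
  field_simp

/-- **The two-kept seed is a shifted plain seed**: for `d ≥ 2n+3` and any `j₀, j₁`,
`Tw_{n+3}[sin²(k_{j₀}) sin²(k_{j₁})](0; 0) = c · d²/((n+1)(n+2)) · I_{n+1,0}(e_{j₀} + e_{j₁})` with `c = 1` for `j₀ ≠ j₁`
(two anchors `2πI_1·d/τ`) and `c = 3` for `j₀ = j₁` (the `sin⁴` anchor `6πI_2·(d/τ)²`, level `2e_{j₀}`).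
[cite: FitznerVanDerHofstad2016NoBLE, (3.35) p. 1071, §5.1.1 (5.2)–(5.4); DLMF, 10.29.1] -/
theorem srwTwist_sinSq_sinSq_zero_eq_srwI (n : ℕ) (hd : 2 * n + 3 ≤ d) (j0 j1 : Fin d) :
    srwTwist d (n + 3) (fun k => Real.sin (k j0) ^ 2 * Real.sin (k j1) ^ 2) 0 0
      = (if j0 = j1 then (3 : ℝ) else 1) * ((d : ℝ) ^ 2 / ((n + 1) * (n + 2)))
        * srwI d (n + 1) 0 (Pi.single j0 1 + Pi.single j1 1) := by
  have hd' : 2 * (n + 1) + 1 ≤ d := by omega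
  have hd1 : 1 ≤ d := by omega
  have hd2 : 2 ≤ d := by omega
  have hd0 : (0 : ℝ) < d := by exact_mod_cast (by omega : 0 < d)
  have hπ0 : (0 : ℝ) < 2 * π := by positivity
  have e2 : srwTwist d (n + 3) (fun k => Real.sin (k j0) ^ 2 * Real.sin (k j1) ^ 2) 0 0
      = ((n + 2) ! : ℝ)⁻¹ * (∫ τ in Ioi (0:ℝ), τ ^ (n + 2) * (Real.exp (-τ) * ∏ μ : Fin d,
          (if μ = j0 then
            (if μ = j1 then π / 4 * (3 * besselI 0 (τ / d) - 4 * besselI 2 (τ / d) + besselI 4 (τ / d))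
              else π * (besselI 0 (τ / d) - besselI 2 (τ / d)))
           else
            (if μ = j1 then π * (besselI 0 (τ / d) - besselI 2 (τ / d))
              else 2 * π * besselI 0 (τ / d))))) / (2 * π) ^ d :=
    srwTwist_sinSq_sinSq_zero_eq_integral_keptAnchor₂ (n + 1) hd' j0 j1
  rw [e2, srwI_succ_zero_eq_integral_prod_srwHeatKernel_div n hd]
  by_cases hj : j0 = j1
  · subst hj
    simp only [if_true]
    have hpt : ∀ τ : ℝ, τ ∈ Ioi (0:ℝ) → τ ^ (n + 2) * (Real.exp (-τ) * ∏ μ : Fin d,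
        (if μ = j0 then
          (if μ = j0 then π / 4 * (3 * besselI 0 (τ / d) - 4 * besselI 2 (τ / d) + besselI 4 (τ / d))
            else π * (besselI 0 (τ / d) - besselI 2 (τ / d)))
         else (if μ = j0 then π * (besselI 0 (τ / d) - besselI 2 (τ / d)) else 2 * π * besselI 0 (τ / d))))
        = (2 * π) ^ d * (3 * (d : ℝ) ^ 2) * (τ ^ n
          * ∏ μ : Fin d, srwHeatKernel (τ / d) ((Pi.single j0 (1:ℤ) + Pi.single j0 (1:ℤ) : Fin d → ℤ) μ)) := by
      intro τ hτ
      have hτ' : (0:ℝ) < τ := hτ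
      have eA : (∏ μ : Fin d, (if μ = j0 then
            (if μ = j0 then π / 4 * (3 * besselI 0 (τ / d) - 4 * besselI 2 (τ / d) + besselI 4 (τ / d))
              else π * (besselI 0 (τ / d) - besselI 2 (τ / d)))
           else (if μ = j0 then π * (besselI 0 (τ / d) - besselI 2 (τ / d)) else 2 * π * besselI 0 (τ / d))))
          = π / 4 * (3 * besselI 0 (τ / d) - 4 * besselI 2 (τ / d) + besselI 4 (τ / d))
            * (2 * π * besselI 0 (τ / d)) ^ (d - 1) := by
        rw [← Finset.mul_prod_erase Finset.univ _ (Finset.mem_univ j0), if_pos rfl, if_pos rfl]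
        congr 1
        rw [Finset.prod_congr rfl (fun μ hμ => by
            rw [if_neg (Finset.ne_of_mem_erase hμ), if_neg (Finset.ne_of_mem_erase hμ)]),
          Finset.prod_const, Finset.card_erase_of_mem (Finset.mem_univ j0), Finset.card_univ,
          Fintype.card_fin]
      have hq : ∏ μ : Fin d, srwHeatKernel (τ / d) ((Pi.single j0 (1:ℤ) + Pi.single j0 (1:ℤ) : Fin d → ℤ) μ)
          = srwHeatKernel (τ / d) 2 * srwHeatKernel (τ / d) 0 ^ (d - 1) := by
        rw [← Finset.mul_prod_erase Finset.univ _ (Finset.mem_univ j0)]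
        congr 1
        · rw [Pi.add_apply, Pi.single_eq_same]; norm_num
        · rw [Finset.prod_congr rfl (fun μ hμ => by
              rw [Pi.add_apply, Pi.single_eq_of_ne (Finset.ne_of_mem_erase hμ), add_zero]),
            Finset.prod_const, Finset.card_erase_of_mem (Finset.mem_univ j0), Finset.card_univ,
            Fintype.card_fin]
      rw [eA, hq, sinFourAnchor_eq_mul_div_sq hτ' hd0, srwHeatKernel_eq_exp_neg_mul_besselI (τ / d) 2,
        srwHeatKernel_eq_exp_neg_mul_besselI (τ / d) 0, exp_neg_eq_mul_pow hd1 (τ := τ),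
        mul_pow (2 * π) (besselI 0 (τ / d)) (d - 1), mul_pow (Real.exp (-(τ / d))) (besselI 0 (τ / d)) (d - 1),
        show (2 * π) ^ d = 2 * π * (2 * π) ^ (d - 1) by rw [← pow_succ', Nat.sub_add_cancel hd1]]
      have e5 : τ ^ (n + 2) * (((d : ℝ) / τ) ^ 2) = (d : ℝ) ^ 2 * τ ^ n := by
        have hτ0 : τ ≠ 0 := hτ'.ne'
        field_simp
        ring
      calc τ ^ (n + 2) * (Real.exp (-(τ / d)) * Real.exp (-(τ / d)) ^ (d - 1)
            * (2 * π * besselI 2 (τ / d) * (3 * ((d : ℝ) / τ) ^ 2)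
              * ((2 * π) ^ (d - 1) * besselI 0 (τ / d) ^ (d - 1))))
          = 3 * (τ ^ (n + 2) * (((d : ℝ) / τ) ^ 2)) * (2 * π * (2 * π) ^ (d - 1))
            * ((Real.exp (-(τ / d)) * besselI 2 (τ / d))
              * (Real.exp (-(τ / d)) ^ (d - 1) * besselI 0 (τ / d) ^ (d - 1))) := by ring
        _ = 2 * π * (2 * π) ^ (d - 1) * (3 * (d : ℝ) ^ 2) * (τ ^ n * ((Real.exp (-(τ / d)) * besselI 2 (τ / d))
              * (Real.exp (-(τ / d)) ^ (d - 1) * besselI 0 (τ / d) ^ (d - 1)))) := by rw [e5]; ring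
    rw [setIntegral_congr_fun measurableSet_Ioi hpt, integral_const_mul]
    rw [Nat.factorial_succ, Nat.factorial_succ]
    push_cast
    have hn0 : (n ! : ℝ) ≠ 0 := by positivity
    have hn1 : ((n : ℝ) + 1) ≠ 0 := by positivity
    have hn2 : ((n : ℝ) + 2) ≠ 0 := by positivity
    have hn2' : ((n : ℝ) + 1 + 1) ≠ 0 := by positivity
    field_simp
    ring
  · simp only [hj, if_false, one_mul]
    have hpt : ∀ τ : ℝ, τ ∈ Ioi (0:ℝ) → τ ^ (n + 2) * (Real.exp (-τ) * ∏ μ : Fin d,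
        (if μ = j0 then
          (if μ = j1 then π / 4 * (3 * besselI 0 (τ / d) - 4 * besselI 2 (τ / d) + besselI 4 (τ / d))
            else π * (besselI 0 (τ / d) - besselI 2 (τ / d)))
         else (if μ = j1 then π * (besselI 0 (τ / d) - besselI 2 (τ / d)) else 2 * π * besselI 0 (τ / d))))
        = (2 * π) ^ d * (d : ℝ) ^ 2 * (τ ^ n
          * ∏ μ : Fin d, srwHeatKernel (τ / d) ((Pi.single j0 (1:ℤ) + Pi.single j1 (1:ℤ) : Fin d → ℤ) μ)) := by
      intro τ hτ
      have hτ' : (0:ℝ) < τ := hτ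
      have eA : (∏ μ : Fin d, (if μ = j0 then
            (if μ = j1 then π / 4 * (3 * besselI 0 (τ / d) - 4 * besselI 2 (τ / d) + besselI 4 (τ / d))
              else π * (besselI 0 (τ / d) - besselI 2 (τ / d)))
           else (if μ = j1 then π * (besselI 0 (τ / d) - besselI 2 (τ / d)) else 2 * π * besselI 0 (τ / d))))
          = (π * (besselI 0 (τ / d) - besselI 2 (τ / d))) ^ 2 * (2 * π * besselI 0 (τ / d)) ^ (d - 2) := by
        rw [← prod_keptAnchor₂_eq hj]
        refine Finset.prod_congr rfl fun μ _ => ?_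
        by_cases h0 : μ = j0
        · subst h0
          simp [hj]
        · by_cases h1 : μ = j1
          · subst h1
            simp [h0]
          · simp [h0, h1]
      have hq : ∏ μ : Fin d, srwHeatKernel (τ / d) ((Pi.single j0 (1:ℤ) + Pi.single j1 (1:ℤ) : Fin d → ℤ) μ)
          = srwHeatKernel (τ / d) 1 ^ 2 * srwHeatKernel (τ / d) 0 ^ (d - 2) := by
        rw [← prod_keptAnchor₂_eq hj]
        refine Finset.prod_congr rfl fun μ _ => ?_
        by_cases h0 : μ = j0
        · subst h0
          simp [hj]
        · by_cases h1 : μ = j1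
          · subst h1
            simp [h0]
          · simp [h0, h1]
      rw [eA, hq, keptAnchor_eq_mul_div hτ' hd0, srwHeatKernel_eq_exp_neg_mul_besselI (τ / d) 1,
        srwHeatKernel_eq_exp_neg_mul_besselI (τ / d) 0, mul_pow (2 * π) (besselI 0 (τ / d)) (d - 2),
        mul_pow (Real.exp (-(τ / d))) (besselI 0 (τ / d)) (d - 2),
        mul_pow (Real.exp (-(τ / d))) (besselI 1 (τ / d)) 2]
      have he : Real.exp (-τ) = Real.exp (-(τ / d)) ^ 2 * Real.exp (-(τ / d)) ^ (d - 2) := by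
        rw [← pow_add, show 2 + (d - 2) = d by omega, ← Real.exp_nat_mul]
        congr 1
        field_simp
      have hpw : (2 * π) ^ d = (2 * π) ^ 2 * (2 * π) ^ (d - 2) := by
        rw [← pow_add, show 2 + (d - 2) = d by omega]
      rw [he, hpw]
      have e5 : τ ^ (n + 2) * (((d : ℝ) / τ) ^ 2) = (d : ℝ) ^ 2 * τ ^ n := by
        have hτ0 : τ ≠ 0 := hτ'.ne'
        field_simp
        ring
      calc τ ^ (n + 2) * (Real.exp (-(τ / d)) ^ 2 * Real.exp (-(τ / d)) ^ (d - 2)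
            * ((2 * π * besselI 1 (τ / d) * (d / τ)) ^ 2 * ((2 * π) ^ (d - 2) * besselI 0 (τ / d) ^ (d - 2))))
          = (τ ^ (n + 2) * (((d : ℝ) / τ) ^ 2)) * ((2 * π) ^ 2 * (2 * π) ^ (d - 2))
            * ((Real.exp (-(τ / d)) ^ 2 * besselI 1 (τ / d) ^ 2)
              * (Real.exp (-(τ / d)) ^ (d - 2) * besselI 0 (τ / d) ^ (d - 2))) := by ring
        _ = (2 * π) ^ 2 * (2 * π) ^ (d - 2) * (d : ℝ) ^ 2 * (τ ^ n
            * ((Real.exp (-(τ / d)) ^ 2 * besselI 1 (τ / d) ^ 2)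
              * (Real.exp (-(τ / d)) ^ (d - 2) * besselI 0 (τ / d) ^ (d - 2)))) := by rw [e5]; ring
    rw [setIntegral_congr_fun measurableSet_Ioi hpt, integral_const_mul]
    rw [Nat.factorial_succ, Nat.factorial_succ]
    push_cast
    have hn0 : (n ! : ℝ) ≠ 0 := by positivity
    have hn1 : ((n : ℝ) + 1) ≠ 0 := by positivity
    have hn2 : ((n : ℝ) + 2) ≠ 0 := by positivity
    have hn2' : ((n : ℝ) + 1 + 1) ≠ 0 := by positivity
    field_simp
    ring

/-! ### Kernel form of the kept literal objects (recurrence substitution)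

At the budgets' top moment index the kept coordinate's Bessel summands `I_k(τ/d)` are, one by one, DIVERGENT plain
seeds — the kept weight is a cancelling combination.  Substituting the recurrence forms of
`SrwTwistKeptRowOrderBall` (`cosPowWeight_sub_eq_sum_recurrence`, `cosPowWeight_sub_two_mul_add_eq_sum_recurrence`)
coordinate-wise and absorbing the factors `d/(2τ)` into the moment turns the one-kept literal object of
`abs_srwTwist_prodCosPowSinSq_sub_prodRowObj_le` into `d/(2(n+1))` times a product literal object ONE index lower,
and the two-kept one of `abs_srwTwist_prodCosPowSinSqSinSq_sub_prodRowObj_le` into `d²/(4(n+1)(n+2))` times one TWO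
indices lower, whose kept rows carry the polynomially weighted entries `(k+1)I_{k+1} − (k−1)I_{k−1}` (resp.
`(k+2)(k+3)I_{k+2} − 2k²I_k + (k−2)(k−3)I_{k−2}` when `j₀ = j₁`) — every term of the lower objects is a finite plain
seed of the existing currency.  Pure identities (no integrability needed).
-/

/-- Pulling `τ`-dependent real scalars out of the coordinates of a product literal object and absorbing them into
the moment: if `F_μ(τ) = r_μ(τ) G_μ(τ)` and `τ^p Π_μ r_μ(τ) = (p!/n!) K τⁿ` on `τ > 0`, then
`Obj_p(F) = K · Obj_n(G)`. [folklore] -/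
private theorem prodObj_eq_mul_prodObj (p n : ℕ) (F G : Fin d → ℝ → ℂ) (r : Fin d → ℝ → ℝ) (K : ℝ)
    (hF : ∀ μ τ, 0 < τ → F μ τ = (r μ τ : ℂ) * G μ τ)
    (hr : ∀ τ, 0 < τ → τ ^ p * ∏ μ, r μ τ = (p ! : ℝ) / n ! * K * τ ^ n) :
    (p ! : ℝ)⁻¹ * (∫ τ in Ioi (0:ℝ), τ ^ p * (Real.exp (-τ) * (∏ μ, F μ τ).re)) / (2 * π) ^ d
      = K * ((n ! : ℝ)⁻¹ * (∫ τ in Ioi (0:ℝ), τ ^ n * (Real.exp (-τ) * (∏ μ, G μ τ).re)) / (2 * π) ^ d) := by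
  have hpt : ∀ τ ∈ Ioi (0:ℝ), τ ^ p * (Real.exp (-τ) * (∏ μ, F μ τ).re)
      = (p ! : ℝ) / n ! * K * (τ ^ n * (Real.exp (-τ) * (∏ μ, G μ τ).re)) := by
    intro τ hτ
    have hτ0 : 0 < τ := hτ
    have hprod : ∏ μ, F μ τ = ((∏ μ, r μ τ : ℝ) : ℂ) * ∏ μ, G μ τ := by
      rw [Complex.ofReal_prod, ← Finset.prod_mul_distrib]
      exact Finset.prod_congr rfl fun μ _ => hF μ τ hτ0
    rw [hprod, Complex.re_ofReal_mul]
    calc τ ^ p * (Real.exp (-τ) * ((∏ μ, r μ τ) * (∏ μ, G μ τ).re))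
        = (τ ^ p * ∏ μ, r μ τ) * (Real.exp (-τ) * (∏ μ, G μ τ).re) := by ring
      _ = (p ! : ℝ) / n ! * K * (τ ^ n * (Real.exp (-τ) * (∏ μ, G μ τ).re)) := by
          rw [hr τ hτ0]; ring
  rw [setIntegral_congr_fun measurableSet_Ioi hpt, integral_const_mul]
  have hp : (p ! : ℝ) ≠ 0 := by positivity
  have hn : (n ! : ℝ) ≠ 0 := by positivity
  field_simp

/-- Factoring a real scalar out of a finite `ℂ`-linear combination of real entries. [folklore] -/
private theorem sum_mul_ofReal_div_eq {ι : Type*} (s : Finset ι) (C : ι → ℂ) (X : ι → ℝ) (w D : ℝ)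
    (hw : ∀ x : ℝ, x / w = D * x) :
    ∑ i ∈ s, C i * ((X i / w : ℝ) : ℂ) = (D : ℂ) * ∑ i ∈ s, C i * (X i : ℂ) := by
  rw [Finset.mul_sum]
  refine Finset.sum_congr rfl fun i _ => ?_
  rw [hw, Complex.ofReal_mul]
  ring

/-- **Kernel form of the ONE-kept literal object.** For `0 < d` and all `n, j₀, m, a, J, c′`: the literal object of
`abs_srwTwist_prodCosPowSinSq_sub_prodRowObj_le` (moment `τ^{n+1}`, kept row weights `W^{(a)}_j − W^{(a+2)}_j` at
`μ = j₀`) equals `d/(2(n+1))` times the product literal object at moment `τⁿ` whose `j₀`-row weights are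
`2^{-a} Σ_s C(a,s)((k_s+1) I_{k_s+1} − (k_s−1) I_{k_s−1})(τ/d)`, `k_s = jm − (2s−a)` — a finite signed sum of plain
literal objects one moment index lower.
[cite: FitznerVanDerHofstad2016NoBLE, (3.35) p. 1071, §5.1.1 (5.2)–(5.5), §5.2 (5.10) p. 1092; DLMF, 10.29.1] -/
theorem keptLitObj_eq_mul_recurrenceLitObj (hd0 : 0 < d) (n : ℕ) (j0 : Fin d) (m : ℤ) (a : Fin d → ℕ) (J : ℕ)
    (c' : Fin d → ℕ → ℂ) :
    ((n + 1) ! : ℝ)⁻¹ * (∫ τ in Ioi (0:ℝ), τ ^ (n + 1) * (Real.exp (-τ) *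
        (∏ μ, ∑ j ∈ Finset.range (J + 1), (if j = 0 then (1 : ℂ) else 2)
          * ((if μ = j0 then
              ((∑ s ∈ Finset.range (a μ + 1), (((a μ).choose s : ℂ) / 2 ^ (a μ))
                    * (besselI (j * m - ((2 * (s : ℤ) - (a μ : ℕ) : ℤ))) (τ / d) : ℂ))
                  - ∑ s ∈ Finset.range (a μ + 2 + 1), (((a μ + 2).choose s : ℂ) / 2 ^ (a μ + 2))
                    * (besselI (j * m - ((2 * (s : ℤ) - (a μ + 2 : ℕ) : ℤ))) (τ / d) : ℂ))
             else
              ∑ s ∈ Finset.range (a μ + 1), (((a μ).choose s : ℂ) / 2 ^ (a μ))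
                    * (besselI (j * m - ((2 * (s : ℤ) - (a μ : ℕ) : ℤ))) (τ / d) : ℂ))
            * c' μ j)).re)) / (2 * π) ^ d
      = (d : ℝ) / (2 * (n + 1)) * ((n ! : ℝ)⁻¹ * (∫ τ in Ioi (0:ℝ), τ ^ n * (Real.exp (-τ) *
        (∏ μ, ∑ j ∈ Finset.range (J + 1), (if j = 0 then (1 : ℂ) else 2)
          * ((if μ = j0 then
              ∑ s ∈ Finset.range (a μ + 1), (((a μ).choose s : ℂ) / 2 ^ (a μ))
                    * ((((j * m - ((2 * (s : ℤ) - (a μ : ℕ) : ℤ)) : ℤ) + 1)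
                        * besselI (j * m - ((2 * (s : ℤ) - (a μ : ℕ) : ℤ)) + 1) (τ / d)
                        - ((j * m - ((2 * (s : ℤ) - (a μ : ℕ) : ℤ)) : ℤ) - 1)
                            * besselI (j * m - ((2 * (s : ℤ) - (a μ : ℕ) : ℤ)) - 1) (τ / d) : ℝ) : ℂ)
             else
              ∑ s ∈ Finset.range (a μ + 1), (((a μ).choose s : ℂ) / 2 ^ (a μ))
                    * (besselI (j * m - ((2 * (s : ℤ) - (a μ : ℕ) : ℤ))) (τ / d) : ℂ))
            * c' μ j)).re)) / (2 * π) ^ d) := by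
  have hd0' : (d : ℝ) ≠ 0 := by exact_mod_cast hd0.ne'
  have hn : (n ! : ℝ) ≠ 0 := by positivity
  refine prodObj_eq_mul_prodObj (n + 1) n _ _ (fun μ τ => if μ = j0 then (d : ℝ) / (2 * τ) else 1) _
    (fun μ τ hτ => ?_) (fun τ hτ => ?_)
  · have hτ0 : τ ≠ 0 := hτ.ne'
    have hv : τ / d ≠ 0 := div_ne_zero hτ0 hd0'
    by_cases hμ : μ = j0
    · subst hμ
      rw [if_pos rfl, Finset.mul_sum]
      refine Finset.sum_congr rfl fun j _ => ?_
      rw [if_pos rfl, if_pos rfl, cosPowWeight_sub_eq_sum_recurrence (a μ) hv m (j : ℤ),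
        sum_mul_ofReal_div_eq _ _ _ (2 * (τ / d)) ((d : ℝ) / (2 * τ)) (fun x => by field_simp)]
      ring
    · rw [if_neg hμ, Complex.ofReal_one, one_mul]
      exact Finset.sum_congr rfl fun j _ => by rw [if_neg hμ, if_neg hμ]
  · have hτ0 : τ ≠ 0 := hτ.ne'
    rw [Finset.prod_ite_eq']
    simp only [Finset.mem_univ, if_true, Nat.factorial_succ]
    push_cast
    field_simp
    ring

/-- **Kernel form of the TWO-kept literal object** (`j₀ ≠ j₁`: both kept rows in first-order recurrence form;
`j₀ = j₁`: the sin⁴ row in second-order form): the literal object of `abs_srwTwist_prodCosPowSinSqSinSq_sub_prodRowObj_le`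
(moment `τ^{n+2}`) equals `d²/(4(n+1)(n+2))` times the product literal object at moment `τⁿ` with the recurrence rows —
a finite signed sum of plain literal objects two moment indices lower.
[cite: FitznerVanDerHofstad2016NoBLE, (3.35) p. 1071, §5.1.1 (5.2)–(5.5), §5.2 (5.10), (5.14) p. 1092; DLMF, 10.29.1] -/
theorem keptLitObj₂_eq_mul_recurrenceLitObj (hd0 : 0 < d) (n : ℕ) (j0 j1 : Fin d) (m : ℤ) (a : Fin d → ℕ)
    (J : ℕ) (c' : Fin d → ℕ → ℂ) :
    ((n + 2) ! : ℝ)⁻¹ * (∫ τ in Ioi (0:ℝ), τ ^ (n + 2) * (Real.exp (-τ) *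
        (∏ μ, ∑ j ∈ Finset.range (J + 1), (if j = 0 then (1 : ℂ) else 2)
          * ((if μ = j0 then
              (if μ = j1 then
                ((∑ s ∈ Finset.range (a μ + 1), (((a μ).choose s : ℂ) / 2 ^ (a μ))
                    * (besselI (j * m - ((2 * (s : ℤ) - (a μ : ℕ) : ℤ))) (τ / d) : ℂ))
                  - 2 * (∑ s ∈ Finset.range (a μ + 2 + 1), (((a μ + 2).choose s : ℂ) / 2 ^ (a μ + 2))
                    * (besselI (j * m - ((2 * (s : ℤ) - (a μ + 2 : ℕ) : ℤ))) (τ / d) : ℂ))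
                  + ∑ s ∈ Finset.range (a μ + 4 + 1), (((a μ + 4).choose s : ℂ) / 2 ^ (a μ + 4))
                    * (besselI (j * m - ((2 * (s : ℤ) - (a μ + 4 : ℕ) : ℤ))) (τ / d) : ℂ))
               else
                ((∑ s ∈ Finset.range (a μ + 1), (((a μ).choose s : ℂ) / 2 ^ (a μ))
                    * (besselI (j * m - ((2 * (s : ℤ) - (a μ : ℕ) : ℤ))) (τ / d) : ℂ))
                  - ∑ s ∈ Finset.range (a μ + 2 + 1), (((a μ + 2).choose s : ℂ) / 2 ^ (a μ + 2))
                    * (besselI (j * m - ((2 * (s : ℤ) - (a μ + 2 : ℕ) : ℤ))) (τ / d) : ℂ)))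
             else
              (if μ = j1 then
                ((∑ s ∈ Finset.range (a μ + 1), (((a μ).choose s : ℂ) / 2 ^ (a μ))
                    * (besselI (j * m - ((2 * (s : ℤ) - (a μ : ℕ) : ℤ))) (τ / d) : ℂ))
                  - ∑ s ∈ Finset.range (a μ + 2 + 1), (((a μ + 2).choose s : ℂ) / 2 ^ (a μ + 2))
                    * (besselI (j * m - ((2 * (s : ℤ) - (a μ + 2 : ℕ) : ℤ))) (τ / d) : ℂ))
               else
                ∑ s ∈ Finset.range (a μ + 1), (((a μ).choose s : ℂ) / 2 ^ (a μ))
                    * (besselI (j * m - ((2 * (s : ℤ) - (a μ : ℕ) : ℤ))) (τ / d) : ℂ)))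
            * c' μ j)).re)) / (2 * π) ^ d
      = (d : ℝ) ^ 2 / (4 * ((n + 1) * (n + 2))) * ((n ! : ℝ)⁻¹ * (∫ τ in Ioi (0:ℝ), τ ^ n * (Real.exp (-τ) *
        (∏ μ, ∑ j ∈ Finset.range (J + 1), (if j = 0 then (1 : ℂ) else 2)
          * ((if μ = j0 then
              (if μ = j1 then
                ∑ s ∈ Finset.range (a μ + 1), (((a μ).choose s : ℂ) / 2 ^ (a μ))
                    * ((((((j * m - ((2 * (s : ℤ) - (a μ : ℕ) : ℤ))) : ℤ) : ℝ) + 2) * ((((j * m - ((2 * (s : ℤ) - (a μ : ℕ) : ℤ))) : ℤ) : ℝ) + 3)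
                        * besselI (j * m - ((2 * (s : ℤ) - (a μ : ℕ) : ℤ)) + 2) (τ / d)
                        - 2 * (((j * m - ((2 * (s : ℤ) - (a μ : ℕ) : ℤ))) : ℤ) : ℝ) ^ 2
                            * besselI (j * m - ((2 * (s : ℤ) - (a μ : ℕ) : ℤ))) (τ / d)
                        + ((((j * m - ((2 * (s : ℤ) - (a μ : ℕ) : ℤ))) : ℤ) : ℝ) - 2) * ((((j * m - ((2 * (s : ℤ) - (a μ : ℕ) : ℤ))) : ℤ) : ℝ) - 3)
                            * besselI (j * m - ((2 * (s : ℤ) - (a μ : ℕ) : ℤ)) - 2) (τ / d) : ℝ) : ℂ)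
               else
                ∑ s ∈ Finset.range (a μ + 1), (((a μ).choose s : ℂ) / 2 ^ (a μ))
                    * ((((j * m - ((2 * (s : ℤ) - (a μ : ℕ) : ℤ)) : ℤ) + 1)
                        * besselI (j * m - ((2 * (s : ℤ) - (a μ : ℕ) : ℤ)) + 1) (τ / d)
                        - ((j * m - ((2 * (s : ℤ) - (a μ : ℕ) : ℤ)) : ℤ) - 1)
                            * besselI (j * m - ((2 * (s : ℤ) - (a μ : ℕ) : ℤ)) - 1) (τ / d) : ℝ) : ℂ))
             else
              (if μ = j1 then
                ∑ s ∈ Finset.range (a μ + 1), (((a μ).choose s : ℂ) / 2 ^ (a μ))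
                    * ((((j * m - ((2 * (s : ℤ) - (a μ : ℕ) : ℤ)) : ℤ) + 1)
                        * besselI (j * m - ((2 * (s : ℤ) - (a μ : ℕ) : ℤ)) + 1) (τ / d)
                        - ((j * m - ((2 * (s : ℤ) - (a μ : ℕ) : ℤ)) : ℤ) - 1)
                            * besselI (j * m - ((2 * (s : ℤ) - (a μ : ℕ) : ℤ)) - 1) (τ / d) : ℝ) : ℂ)
               else
                ∑ s ∈ Finset.range (a μ + 1), (((a μ).choose s : ℂ) / 2 ^ (a μ))
                    * (besselI (j * m - ((2 * (s : ℤ) - (a μ : ℕ) : ℤ))) (τ / d) : ℂ)))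
            * c' μ j)).re)) / (2 * π) ^ d) := by
  have hd0' : (d : ℝ) ≠ 0 := by exact_mod_cast hd0.ne'
  have hn : (n ! : ℝ) ≠ 0 := by positivity
  refine prodObj_eq_mul_prodObj (n + 2) n _ _
    (fun μ τ => (if μ = j0 then (d : ℝ) / (2 * τ) else 1) * (if μ = j1 then (d : ℝ) / (2 * τ) else 1)) _
    (fun μ τ hτ => ?_) (fun τ hτ => ?_)
  · have hτ0 : τ ≠ 0 := hτ.ne'
    have hv : τ / d ≠ 0 := div_ne_zero hτ0 hd0'
    by_cases hμ : μ = j0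
    · subst hμ
      by_cases hμ1 : μ = j1
      · subst hμ1
        simp only [if_true]
        rw [Finset.mul_sum]
        refine Finset.sum_congr rfl fun j _ => ?_
        rw [cosPowWeight_sub_two_mul_add_eq_sum_recurrence (a μ) hv m (j : ℤ),
          sum_mul_ofReal_div_eq _ _ _ (4 * (τ / d) ^ 2) ((d : ℝ) / (2 * τ) * ((d : ℝ) / (2 * τ)))
            (fun x => by field_simp; ring)]
        ring
      · rw [if_pos rfl, if_neg hμ1, mul_one, Finset.mul_sum]
        refine Finset.sum_congr rfl fun j _ => ?_
        rw [if_pos rfl, if_pos rfl, if_neg hμ1, if_neg hμ1, cosPowWeight_sub_eq_sum_recurrence (a μ) hv m (j : ℤ),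
          sum_mul_ofReal_div_eq _ _ _ (2 * (τ / d)) ((d : ℝ) / (2 * τ)) (fun x => by field_simp)]
        ring
    · by_cases hμ1 : μ = j1
      · subst hμ1
        rw [if_neg hμ, if_pos rfl, one_mul, Finset.mul_sum]
        refine Finset.sum_congr rfl fun j _ => ?_
        rw [if_neg hμ, if_neg hμ, if_pos rfl, if_pos rfl, cosPowWeight_sub_eq_sum_recurrence (a μ) hv m (j : ℤ),
          sum_mul_ofReal_div_eq _ _ _ (2 * (τ / d)) ((d : ℝ) / (2 * τ)) (fun x => by field_simp)]
        ring
      · rw [if_neg hμ, if_neg hμ1, one_mul, Complex.ofReal_one, one_mul]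
        exact Finset.sum_congr rfl fun j _ => by rw [if_neg hμ, if_neg hμ, if_neg hμ1, if_neg hμ1]
  · have hτ0 : τ ≠ 0 := hτ.ne'
    rw [Finset.prod_mul_distrib, Finset.prod_ite_eq', Finset.prod_ite_eq']
    simp only [Finset.mem_univ, if_true, Nat.factorial_succ]
    push_cast
    field_simp
    ring

/-! ### Consumer form: kernel-form object, seed in the existing currency -/

/-- **One-kept budget, consumer form.** The one-kept budget `abs_srwTwist_prodCosPowSinSq_sub_prodRowObj_le` with its
literal object rewritten in kernel form (`keptLitObj_eq_mul_recurrenceLitObj`: `d/(2(n+1))` times the moment-`n`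
product object with the recurrence row at `j₀`) and its seed in the programme's currency
(`srwTwist_sinSq_zero_eq_srwI`: `Tw_{n+2}[sin²_{j₀}](0;0) = (d/(n+1))·I_{n+1,0}(e_{j₀})`): for `d ≥ 2n+3`, `m ≠ 0`,
`|Tw_{n+2}[Π_μ cos^{a_μ} sin²_{j₀}](m e_i; β) − (d/(2(n+1)))·Obj_n(P̃(c′))| ≤ [bracket] · (d/(n+1)) I_{n+1,0}(e_{j₀})`.
[cite: FitznerVanDerHofstad2016NoBLE, (3.34)–(3.38) p. 1071, §5.1.1 (5.2)–(5.5), §5.2 (5.9)–(5.10), (5.14); DLMF, 10.29.1] -/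
theorem abs_srwTwist_prodCosPowSinSq_sub_recurrenceLitObj_le (n : ℕ) (hd : 2 * n + 3 ≤ d) (i j0 : Fin d)
    {m : ℤ} (hm : m ≠ 0) (β : ℝ) (a : Fin d → ℕ) (J : ℕ) (c' : Fin d → ℕ → ℂ) :
    |srwTwist d (n + 2) (fun k => ∏ μ, Real.cos (k μ) ^ a μ
        * (if μ = j0 then Real.sin (k μ) ^ 2 else 1)) (Pi.single i m) β
      - (d : ℝ) / (2 * (n + 1)) * ((n ! : ℝ)⁻¹ * (∫ τ in Ioi (0:ℝ), τ ^ n * (Real.exp (-τ) *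
        (∏ μ, ∑ j ∈ Finset.range (J + 1), (if j = 0 then (1 : ℂ) else 2)
          * ((if μ = j0 then
              ∑ s ∈ Finset.range (a μ + 1), (((a μ).choose s : ℂ) / 2 ^ (a μ))
                    * ((((j * m - ((2 * (s : ℤ) - (a μ : ℕ) : ℤ)) : ℤ) + 1)
                        * besselI (j * m - ((2 * (s : ℤ) - (a μ : ℕ) : ℤ)) + 1) (τ / d)
                        - ((j * m - ((2 * (s : ℤ) - (a μ : ℕ) : ℤ)) : ℤ) - 1)
                            * besselI (j * m - ((2 * (s : ℤ) - (a μ : ℕ) : ℤ)) - 1) (τ / d) : ℝ) : ℂ)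
             else
              ∑ s ∈ Finset.range (a μ + 1), (((a μ).choose s : ℂ) / 2 ^ (a μ))
                    * (besselI (j * m - ((2 * (s : ℤ) - (a μ : ℕ) : ℤ))) (τ / d) : ℂ))
            * c' μ j)).re)) / (2 * π) ^ d)|
    ≤ (((1 + 2 * ∑' l : ℕ, |besselJ (l + J + 1) (β / d)|) ^ d - 1)
        + ((∏ μ, ((∑ j ∈ Finset.range (J + 1), (if j = 0 then (1 : ℝ) else 2) * ‖c' μ j‖)
            + ∑ j ∈ Finset.range (J + 1), (if j = 0 then (1 : ℝ) else 2)
              * ‖2 * π * Complex.I ^ j * (besselJ j (β / d) : ℂ) - c' μ j‖))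
          - ∏ μ, ∑ j ∈ Finset.range (J + 1), (if j = 0 then (1 : ℝ) else 2) * ‖c' μ j‖) / (2 * π) ^ d)
      * ((d : ℝ) / (n + 1) * srwI d (n + 1) 0 (Pi.single j0 1)) := by
  have h := abs_srwTwist_prodCosPowSinSq_sub_prodRowObj_le n hd i j0 hm β a J c'
  rw [keptLitObj_eq_mul_recurrenceLitObj (by omega) n j0 m a J c', srwTwist_sinSq_zero_eq_srwI n hd j0] at h
  exact h

/-- **Two-kept budget, consumer form.** `abs_srwTwist_prodCosPowSinSqSinSq_sub_prodRowObj_le` with the literal object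
in kernel form (`keptLitObj₂_eq_mul_recurrenceLitObj`: `d²/(4(n+1)(n+2))` times the moment-`n` product object with the
recurrence rows) and the seed in the programme's currency (`srwTwist_sinSq_sinSq_zero_eq_srwI`:
`Tw_{n+3}[sin²_{j₀} sin²_{j₁}](0;0) = c·d²/((n+1)(n+2))·I_{n+1,0}(e_{j₀}+e_{j₁})`, `c = 3` if `j₀ = j₁` else `1`).
[cite: FitznerVanDerHofstad2016NoBLE, (3.34)–(3.38) p. 1071, §5.1.1 (5.2)–(5.5), §5.2 (5.9)–(5.10), (5.14); DLMF, 10.29.1] -/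
theorem abs_srwTwist_prodCosPowSinSqSinSq_sub_recurrenceLitObj_le (n : ℕ) (hd : 2 * n + 3 ≤ d)
    (i j0 j1 : Fin d) {m : ℤ} (hm : m ≠ 0) (β : ℝ) (a : Fin d → ℕ) (J : ℕ) (c' : Fin d → ℕ → ℂ) :
    |srwTwist d (n + 3) (fun k => ∏ μ, Real.cos (k μ) ^ a μ
        * (if μ = j0 then Real.sin (k μ) ^ 2 else 1) * (if μ = j1 then Real.sin (k μ) ^ 2 else 1))
        (Pi.single i m) β
      - (d : ℝ) ^ 2 / (4 * ((n + 1) * (n + 2))) * ((n ! : ℝ)⁻¹ * (∫ τ in Ioi (0:ℝ), τ ^ n * (Real.exp (-τ) *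
        (∏ μ, ∑ j ∈ Finset.range (J + 1), (if j = 0 then (1 : ℂ) else 2)
          * ((if μ = j0 then
              (if μ = j1 then
                ∑ s ∈ Finset.range (a μ + 1), (((a μ).choose s : ℂ) / 2 ^ (a μ))
                    * ((((((j * m - ((2 * (s : ℤ) - (a μ : ℕ) : ℤ))) : ℤ) : ℝ) + 2) * ((((j * m - ((2 * (s : ℤ) - (a μ : ℕ) : ℤ))) : ℤ) : ℝ) + 3)
                        * besselI (j * m - ((2 * (s : ℤ) - (a μ : ℕ) : ℤ)) + 2) (τ / d)
                        - 2 * (((j * m - ((2 * (s : ℤ) - (a μ : ℕ) : ℤ))) : ℤ) : ℝ) ^ 2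
                            * besselI (j * m - ((2 * (s : ℤ) - (a μ : ℕ) : ℤ))) (τ / d)
                        + ((((j * m - ((2 * (s : ℤ) - (a μ : ℕ) : ℤ))) : ℤ) : ℝ) - 2) * ((((j * m - ((2 * (s : ℤ) - (a μ : ℕ) : ℤ))) : ℤ) : ℝ) - 3)
                            * besselI (j * m - ((2 * (s : ℤ) - (a μ : ℕ) : ℤ)) - 2) (τ / d) : ℝ) : ℂ)
               else
                ∑ s ∈ Finset.range (a μ + 1), (((a μ).choose s : ℂ) / 2 ^ (a μ))
                    * ((((j * m - ((2 * (s : ℤ) - (a μ : ℕ) : ℤ)) : ℤ) + 1)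
                        * besselI (j * m - ((2 * (s : ℤ) - (a μ : ℕ) : ℤ)) + 1) (τ / d)
                        - ((j * m - ((2 * (s : ℤ) - (a μ : ℕ) : ℤ)) : ℤ) - 1)
                            * besselI (j * m - ((2 * (s : ℤ) - (a μ : ℕ) : ℤ)) - 1) (τ / d) : ℝ) : ℂ))
             else
              (if μ = j1 then
                ∑ s ∈ Finset.range (a μ + 1), (((a μ).choose s : ℂ) / 2 ^ (a μ))
                    * ((((j * m - ((2 * (s : ℤ) - (a μ : ℕ) : ℤ)) : ℤ) + 1)
                        * besselI (j * m - ((2 * (s : ℤ) - (a μ : ℕ) : ℤ)) + 1) (τ / d)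
                        - ((j * m - ((2 * (s : ℤ) - (a μ : ℕ) : ℤ)) : ℤ) - 1)
                            * besselI (j * m - ((2 * (s : ℤ) - (a μ : ℕ) : ℤ)) - 1) (τ / d) : ℝ) : ℂ)
               else
                ∑ s ∈ Finset.range (a μ + 1), (((a μ).choose s : ℂ) / 2 ^ (a μ))
                    * (besselI (j * m - ((2 * (s : ℤ) - (a μ : ℕ) : ℤ))) (τ / d) : ℂ)))
            * c' μ j)).re)) / (2 * π) ^ d)|
    ≤ (((1 + 2 * ∑' l : ℕ, |besselJ (l + J + 1) (β / d)|) ^ d - 1)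
        + ((∏ μ, ((∑ j ∈ Finset.range (J + 1), (if j = 0 then (1 : ℝ) else 2) * ‖c' μ j‖)
            + ∑ j ∈ Finset.range (J + 1), (if j = 0 then (1 : ℝ) else 2)
              * ‖2 * π * Complex.I ^ j * (besselJ j (β / d) : ℂ) - c' μ j‖))
          - ∏ μ, ∑ j ∈ Finset.range (J + 1), (if j = 0 then (1 : ℝ) else 2) * ‖c' μ j‖) / (2 * π) ^ d)
      * ((if j0 = j1 then (3 : ℝ) else 1) * ((d : ℝ) ^ 2 / ((n + 1) * (n + 2)))
        * srwI d (n + 1) 0 (Pi.single j0 1 + Pi.single j1 1)) := by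
  have h := abs_srwTwist_prodCosPowSinSqSinSq_sub_prodRowObj_le n hd i j0 j1 hm β a J c'
  rw [keptLitObj₂_eq_mul_recurrenceLitObj (by omega) n j0 j1 m a J c',
    srwTwist_sinSq_sinSq_zero_eq_srwI n hd j0 j1] at h
  exact h

end Literature.Probability.FitznerVanDerHofstad2017

end
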